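import Literature.MathematicalPhysics.QuantumFieldTheory.Balaban1983to89.B3Ineq212ZeroBox
import Literature.MathematicalPhysics.QuantumFieldTheory.Balaban1983to89.B4Thm19ZeroBoxHolder

/-!
# `Balaban1983to89.B3Ineq211ZeroBox` — T. Bałaban, *(Higgs)₂,₃ quantum fields in a finite volume. III. Renormalization*,
# Commun. Math. Phys. **88** (1983) 411–445 [Balaban1983Higgs3]: the Hölder form (2.11) p. 426 of the scale-piece bounds,
# `(1/|x₂−x₁|^α)|U(B̃(Γ_{x₁,x₂}))(D^η_{B̃,μ}G^η_{(j)})(x₂,x) − (D^η_{B̃,μ}G^η_{(j)})(x₁,x)| ≤ O(1)(L^jη)^{−d+1−α}e^{−δ₁(L^jη)^{−1}dist({x₁,x₂},x)}`,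
# PROVED for the MODEL INSTANCE `A = B̃ = 0`, `Ω = □` a rectangular parallelepiped, every scale `k ≥ 1`, FOR EACH `0 ≤ α < 1`
# (constants depending on `α`) — the clause of `ScaledKernels.Ineq211` at `α` DISCHARGED for the concrete carrier `zeroBoxKernelsH`,
# with `Ineq210`/`Ineq212` carried over

statement-level skeleton of published theorems with citation tags; proofs where landed; nothing here is a claim about the Yang–Mills mass gap

PDF held: `paper:balaban1983-higgs-2-3-quantum-fields-finite-volume` (journal page = PDF page + 410); p. 426 [PDF 16] (2.10)–(2.12) read
on the render `run/shared/lean/pub/pub-balaban/b2b-balaban-ref1/pages/1983-cmp88-higgs23-III/1983-cmp88-higgs23-III-p016-x2.png`;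
[B4] = T. Bałaban, *Regularity and decay of lattice Green's functions*, Commun. Math. Phys. **89** (1983) 571–597
[Balaban1983RegularityDecay], p. 573 Theorem 1.1′/(1.9) and p. 582 Lemma 2.4 (2.36), (2.38)–(2.39) (tree: `B4Thm19ZeroBoxHolder`).

CITATION HEADER (lean-in-tree rule).  Part of the lit-balaban TYPED SKELETON (HOME `run/shared/lean/pub/lit-balaban/`), Phase 2:
SKELETON row **B3.Eq2.11** (`HOME/lit-balaban-r15/ROWS-B3.md`, fold owner r15; decl of record `B3Sect2StatementsPart2.ScaledKernels.Ineq211`,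
typed p239134 over the ABSTRACT carrier `ScaledKernels`); companion of `B3Ineq210ZeroBox` (row B3.Eq2.10, p253409) and `B3Ineq212ZeroBox`
(row B3.Eq2.12, p254210).  WHAT IS PRINTED (B3 p. 426): *"For the propagators G^η_{(j)} we apply the inequality |G^η_{(j)}(Ω, B̃; x, x′)| ≤
O(1)(L^jη)^{−d+2}e^{−δ₁(L^jη)^{−1}|x−x′|}, (2.10) and if the propagator is differentiated, then for each differentiation, there is an
additional factor (L^jη)^{−1} on the right side. This applies also to Hölder norms, e.g. we have
(1/|x₂−x₁|^α)|U(B̃(Γ_{x₁,x₂}))(D^η_{B̃,μ}G^η_{(j)})(Ω,B̃;x₂,x) − (D^η_{B̃,μ}G^η_{(j)})(Ω,B̃;x₁,x)| ≤ O(1)(L^jη)^{−d+1−α}e^{−δ₁(L^jη)^{−1}dist({x₁,x₂},x)},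
0 ≤ α < 1. (2.11) … They all are obtained by rescaling from the η-lattice to the L^{−j}-lattice and application of Propositions I.2.1
and I.2.3."*; ([B4] p. 573, the cited Proposition I.2.1 = Theorem 1.1′): *"For α < 1 there exist positive constants δ₀, c₀, R₀
independent of A, k, Ω and depending on d, M only, c₀ on α also, such that …
|x − x′|^{−α}|U(A(Γ_{x,x′}))(D^η_{A,μ}G_k(Ω, A)f)(x′) − (D^η_{A,μ}G_k(Ω, A)f)(x)| ≤ c₀ exp(−δ₀ dist({x, x′}, supp f))‖f‖_∞ (1.9)"*.

WHAT IS REPRODUCED, and how (kind «model-instance», G.1 of `HOME/PHASE2-TARGETS.md`; same instance as `B3Ineq210ZeroBox`).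
* §1 the TWO-CENTRE pointwise triple-product estimate (`abs_sum2_le2`, private): a vector decaying about the pair `{β₁,β₂}`, a
  kernel decaying off the diagonal and a vector decaying about `β′` have `|Σ_{y′,y} g(y)C(y,y′)h(y′)| ≤ 2c_Ac_Cc_BK²e^{−ρ·min(|β₁−β′|,|β₂−β′|)}`
  (split `g` by the nearer centre; twice the one-centre estimate of `B3Ineq210ZeroBox`).
* §2 block bookkeeping (`L^k = s_jb_j`, `(s^{-1})^{1−n−α} = s^n·s^αs^{-1}`, differenced rows of `A_j = 𝒢_jQ_j^*`).
* §3 **(2.11), counting normalisation, piecewise** (`abs_pieceDD_le`): for each `0 ≤ α < 1`, `∃ δ₁ C > 0` with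
  `(L^k/|x₂−x₁|_∞)^α·L^k·|(G_{(j)}(x₂+e_μ,x) − G_{(j)}(x₂,x)) − (G_{(j)}(x₁+e_μ,x) − G_{(j)}(x₁,x))| ≤ C·L^{−j(d+1)}·s_j^αs_j^{−1}·e^{−δ₁min(|x₁−x|,|x₂−x|)/L^j}`
  for all `k ≥ 1`, `j < k`, window points, boxes, axes and sites: `j ≥ 1` from the Hölder block-row form of [B4] (2.36)/(2.38)
  (`B4Thm19ZeroBoxHolder.Gfine_blockRowHolder_bound`) × (2.37) (`B4BoxCov237.cov237_box_decay`) × the value rows of (2.35)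
  (`B4Thm110ZeroBox.Gfine_blockRow_bound`) through §1; `j = 0` crudely (`(L^k/|x₂−x₁|)^α ≤ s_0^α`, `L^k·s_1^{−2} = L²s_0^{−1}`).
* §4 the CARRIER `zeroBoxKernelsH` (= `B3Ineq212ZeroBox.zeroBoxKernelsV` with the (2.11) fields modelled: `dist2 = η·min(|x₁−x|_∞,|x₂−x|_∞)`,
  `holderDiff j μ x₁ x₂ x = η^{−(d+1)}·η^{−1}·|dd G_{(j)}|` on bonds of `□`, `0` otherwise), `ineq210_zeroBoxH`, `ineq212_zeroBoxH` (the (2.10)/(2.12)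
  fields coincide with the earlier carriers, so `ineq210_zeroBox`/`ineq212_zeroBoxV` apply verbatim), and **`ineq211At_zeroBoxH`**:
  `∀ α ∈ [0,1), ∃ δ₁ > 0, C > 0` (on `d`, `L`, the window, `α`) such that for every `k ≥ 1`, window point and box the clause of
  `(zeroBoxKernelsH ℓ k hℓ M a m2).Ineq211 δ₁ C` at exponent `α` holds; `ineq211_iff_forall_clause` records (by `Iff.rfl`) that
  `Ineq211 δ₁ C` is exactly the conjunction of these clauses over `α` at ONE `(δ₁, C)`.
* §5 a non-vacuity witness (`d + 1 = 3`, `L = 2`, `α = 1/2`, `k = 1`, unit cube).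
* §6 (v1.1) INTERPOLATION IN THE EXPONENT: on any carrier with `dist, dist2 ≥ 0` the clauses at `0` and at `α⋆` give the clause
  at every `α ∈ [0, α⋆]` with constants `(min δ, max C)` (`ScaledKernels.ineq211_clause_interpolate`); hence **`ineq211Upto_zeroBoxH`**:
  for every `α⋆ < 1` ONE pair `(δ₁, C)` serving all `α ∈ [0, α⋆]` — the form the print uses ((3.3) p. 433: a fixed `α₀ < 1`).
* §7 (v1.1) the owner's DECL OF RECORD after the G-B3-11 ruling, `ScaledKernels.Ineq211At α δ₁ C` (`B3Sect2StatementsPart2`, r15 gen 5: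
  the display at ONE exponent) DISCHARGED for the instance: **`ineq211At_zeroBoxH'`** (`∀ α ∈ [0,1) ∃ δ₁ C > 0 ∀ k, window, box,
  Ineq211At α δ₁ C`), `ineq211At_zeroBoxH_upto` (one pair on `[0, α⋆]`), `Ineq211At.interpolate`, witness.

HONEST SCOPE / DECLARED DIVERGENCES (F7).  (i) As `B3Ineq210ZeroBox`: only `A = B̃ = 0` (`U(B̃(Γ_{x₁,x₂})) ≡ 1`, one component),
`Ω = □` a box of unit blocks with Neumann conditions, every `k ≥ 1`, running constants in a window; not general `Ω ⊂ T_η`, not the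
torus.  (ii) `D^η_{0,μ}` = the forward difference in the ROW variable along the bonds `⟨xᵢ, xᵢ+ηe_μ⟩ ⊂ □`; when one of the two bonds
leaves `□` the carrier's `holderDiff` is `0` (Neumann: (1.3) of [B4] sums over bonds `b ⊂ Ω`).  (iii) Sup norm for `|x₂ − x₁|` and
`dist({x₁,x₂},x) = min(|x₁−x|_∞,|x₂−x|_∞)` (the print does not fix the norm; the Euclidean form follows with `δ₁/√(d+1)` and a factor
`(d+1)^{α/2} ≤ d+1` in `C`).  (iv) QUANTIFIERS: the print's O(1) in (2.11) is the `c₀` of Proposition I.2.1 = [B4] (1.9), printed to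
depend «on α also»; what is proved is `∀ α ∈ [0,1) ∃ (δ₁, C)` — uniform in `k`, `□`, `j`, `μ`, the points and the window point, NOT
uniform in `α` (the tree's kernel constant of [B4] (2.36), `B4StripSumsHolder.boundGH ∝ ζ(1+(1−α)/(d+1))^{d+1}`, is unbounded as `α → 1`);
uniformity on every `[0, α⋆]`, `α⋆ < 1`, IS proved (§6), but the typed `ScaledKernels.Ineq211 δ₁ C` (one pair for all `α < 1`,
i.e. `sup_{α<1} C(α) < ∞`) is NOT claimed for this instance — recorded as gap G-B3-11 in `HOME/GAPS.md` for the owner of the typed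
row; here `δ₁` may depend on `α⋆` too (it could be taken `α`-free by tracking rates; not done).
(v) Constants existential (print: O(1), δ₁ absolute).  (vi) ROUTE = the print's («rescaling … and application of Propositions I.2.1
and I.2.3» = [B4] Theorem 1.1′ via Lemma 2.4 (2.36) and (2.38)–(2.39)), carried out through the kernel-proved `A = 0` box lineage
(`B4Thm19ZeroBoxHolder` ← `B4StripSumsHolder`, `B4Thm110ZeroBox`, `B4Thm110ZeroBoxDeriv`, `B4BoxCov237`; `B3Ineq210ZeroBox`,
`B3Ineq212ZeroBox`), used BY NAME; no Literature fact is minted, every input is a kernel theorem.  Value = kernel certificate of a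
located by-reference step of B3 for the zero-background box instance, NOT summit progress.
Unit `lit-balaban-p03-g4` (Phase-2 proof seat p03, gen 4); HOME `run/shared/lean/pub/lit-balaban/` (row B3.Eq2.11, FILED.md, STATUS.md, GAPS.md G-B3-11).
-/

namespace Literature.MathematicalPhysics.QuantumFieldTheory.Balaban1983to89.B3Ineq211ZeroBox

open Finset Matrix
open Literature.MathematicalPhysics.QuantumFieldTheory.Balaban1983to89.B4ContourShift
open Literature.MathematicalPhysics.QuantumFieldTheory.Balaban1983to89.B4Reflection242
open Literature.MathematicalPhysics.QuantumFieldTheory.Balaban1983to89.B4BoxCov237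
open Literature.MathematicalPhysics.QuantumFieldTheory.Balaban1983to89.B4Thm110ZeroBox
open Literature.MathematicalPhysics.QuantumFieldTheory.Balaban1983to89.B4Thm110ZeroBoxDeriv
open Literature.MathematicalPhysics.QuantumFieldTheory.Balaban1983to89.B4Thm19ZeroBoxHolder
open Literature.MathematicalPhysics.QuantumFieldTheory.Balaban1983to89.B3Sect2StatementsPart2
open Literature.MathematicalPhysics.QuantumFieldTheory.Balaban1983to89.B3Ineq210ZeroBox
open Literature.MathematicalPhysics.QuantumFieldTheory.Balaban1983to89.B3Ineq212ZeroBox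
open B4StripSumsHolder (one_le_supNorm)
open B4Sect5Proof (latticeConst latticeConst_nonneg)

noncomputable section

variable {d : ℕ}

/-! ## §1 Exponential bookkeeping and the TWO-CENTRE pointwise triple-product estimate -/

/-- kernel: three decaying factors along a chain `β → y → y′ → β′` dominate one decaying factor in `D ≤ p + q + r`
at the rate `min(κ,δ)/2`, keeping half of the first two rates (the one-centre bookkeeping of `B3Ineq210ZeroBox`, private
there). [folklore] -/
private theorem exp_chain3 {κ δ p q r D : ℝ} (hκ : 0 ≤ κ) (hδ : 0 ≤ δ) (hp : 0 ≤ p) (hq : 0 ≤ q) (hr : 0 ≤ r)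
    (hD : D ≤ p + q + r) :
    Real.exp (-(κ * p)) * Real.exp (-(δ * q)) * Real.exp (-(κ * r))
      ≤ Real.exp (-(min κ δ / 2 * D)) * (Real.exp (-(κ / 2 * p)) * Real.exp (-(δ / 2 * q))) := by
  simp only [← Real.exp_add]
  apply Real.exp_le_exp.2
  have h1 : min κ δ ≤ κ := min_le_left _ _
  have h2 : min κ δ ≤ δ := min_le_right _ _
  have h0 : 0 ≤ min κ δ := le_min hκ hδ
  have e1 : min κ δ / 2 * D ≤ min κ δ / 2 * (p + q + r) := mul_le_mul_of_nonneg_left hD (by linarith)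
  have e2 : min κ δ / 2 * p ≤ κ / 2 * p := mul_le_mul_of_nonneg_right (by linarith) hp
  have e3 : min κ δ / 2 * q ≤ δ / 2 * q := mul_le_mul_of_nonneg_right (by linarith) hq
  have e4 : min κ δ / 2 * r ≤ κ * r := mul_le_mul_of_nonneg_right (by linarith) hr
  linarith

/-- kernel: `|β − β′|_∞ ≤ |β − y|_∞ + |y − y′|_∞ + |β′ − y′|_∞`. [folklore] -/
private theorem supNorm_chain (β y y' β' : Fin (d + 1) → ℤ) :
    supNorm (β - β') ≤ supNorm (β - y) + supNorm (y - y') + supNorm (β' - y') := by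
  have t1 := supNorm_sub_le_sub_add_sub β y β'
  have t2 := supNorm_sub_le_sub_add_sub y y' β'
  rw [show supNorm (y' - β') = supNorm (β' - y') from by rw [← B4TorusKernel.supNorm_neg, neg_sub]] at t2
  linarith

section Pointwise

variable {N : Fin (d + 1) → ℕ}

/-- kernel: one term of the one-centre triple product (as in `B3Ineq210ZeroBox`, private there). [folklore] -/
private theorem term3_le (β β' y y' : ↥(boxDom N)) {gy Cyy hy cA cC cB κ δ : ℝ} (hcA : 0 ≤ cA) (hcC : 0 ≤ cC)
    (hκ : 0 < κ) (hδ : 0 < δ)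
    (hg : |gy| ≤ cA * Real.exp (-(κ * supNorm (β.1 - y.1))))
    (hC : |Cyy| ≤ cC * Real.exp (-(δ * supNorm (y.1 - y'.1))))
    (hh : |hy| ≤ cB * Real.exp (-(κ * supNorm (β'.1 - y'.1)))) :
    |gy * Cyy * hy| ≤ cA * cC * cB * Real.exp (-(min κ δ / 2 * supNorm (β.1 - β'.1)))
      * (Real.exp (-(κ / 2 * supNorm (β.1 - y.1))) * Real.exp (-(δ / 2 * supNorm (y.1 - y'.1)))) := by
  have n1 : 0 ≤ cA * Real.exp (-(κ * supNorm (β.1 - y.1))) := mul_nonneg hcA (Real.exp_pos _).le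
  have n2 : 0 ≤ cC * Real.exp (-(δ * supNorm (y.1 - y'.1))) := mul_nonneg hcC (Real.exp_pos _).le
  have hcB : 0 ≤ cB := by
    have h0 : 0 ≤ cB * Real.exp (-(κ * supNorm (β'.1 - y'.1))) := (abs_nonneg hy).trans hh
    exact nonneg_of_mul_nonneg_left h0 (Real.exp_pos _)
  have hprod := mul_le_mul (mul_le_mul hg hC (abs_nonneg _) n1) hh (abs_nonneg _) (mul_nonneg n1 n2)
  have hch := exp_chain3 hκ.le hδ.le (supNorm_nonneg (β.1 - y.1)) (supNorm_nonneg (y.1 - y'.1))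
    (supNorm_nonneg (β'.1 - y'.1)) (supNorm_chain β.1 y.1 y'.1 β'.1)
  have hc0 : 0 ≤ cA * cC * cB := mul_nonneg (mul_nonneg hcA hcC) hcB
  calc |gy * Cyy * hy| = |gy| * |Cyy| * |hy| := by rw [abs_mul, abs_mul]
    _ ≤ cA * Real.exp (-(κ * supNorm (β.1 - y.1))) * (cC * Real.exp (-(δ * supNorm (y.1 - y'.1))))
        * (cB * Real.exp (-(κ * supNorm (β'.1 - y'.1)))) := hprod
    _ = cA * cC * cB * (Real.exp (-(κ * supNorm (β.1 - y.1))) * Real.exp (-(δ * supNorm (y.1 - y'.1)))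
        * Real.exp (-(κ * supNorm (β'.1 - y'.1)))) := by ring
    _ ≤ cA * cC * cB * (Real.exp (-(min κ δ / 2 * supNorm (β.1 - β'.1)))
        * (Real.exp (-(κ / 2 * supNorm (β.1 - y.1))) * Real.exp (-(δ / 2 * supNorm (y.1 - y'.1))))) :=
        mul_le_mul_of_nonneg_left hch hc0
    _ = _ := by ring

/-- kernel: the double geometric sum `Σ_y e^{−(κ/2)|β−y|} Σ_{y′} e^{−(δ/2)|y−y′|} ≤ K(κ/2)K(δ/2)`. [folklore] -/
private theorem sum2_exp_le (β : ↥(boxDom N)) {κ δ : ℝ} (hκ : 0 < κ) (hδ : 0 < δ) :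
    ∑ y' : ↥(boxDom N), ∑ y : ↥(boxDom N),
        Real.exp (-(κ / 2 * supNorm (β.1 - y.1))) * Real.exp (-(δ / 2 * supNorm (y.1 - y'.1)))
      ≤ latticeConst (d + 1) (κ / 2) * latticeConst (d + 1) (δ / 2) := by
  have hKδ : 0 ≤ latticeConst (d + 1) (δ / 2) := latticeConst_nonneg _ (half_pos hδ).le
  have hrowδ : ∀ y : ↥(boxDom N), ∑ y' : ↥(boxDom N), Real.exp (-(δ / 2 * supNorm (y.1 - y'.1)))
      ≤ latticeConst (d + 1) (δ / 2) := fun y => rho_sumBound N (δ / 2) (half_pos hδ) y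
  have hrowκ : ∑ y : ↥(boxDom N), Real.exp (-(κ / 2 * supNorm (β.1 - y.1))) ≤ latticeConst (d + 1) (κ / 2) :=
    rho_sumBound N (κ / 2) (half_pos hκ) β
  rw [Finset.sum_comm]
  calc ∑ y : ↥(boxDom N), ∑ y' : ↥(boxDom N),
          Real.exp (-(κ / 2 * supNorm (β.1 - y.1))) * Real.exp (-(δ / 2 * supNorm (y.1 - y'.1)))
      = ∑ y : ↥(boxDom N), Real.exp (-(κ / 2 * supNorm (β.1 - y.1)))
          * ∑ y' : ↥(boxDom N), Real.exp (-(δ / 2 * supNorm (y.1 - y'.1))) := by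
        refine Finset.sum_congr rfl fun y _ => ?_
        rw [Finset.mul_sum]
    _ ≤ ∑ y : ↥(boxDom N), Real.exp (-(κ / 2 * supNorm (β.1 - y.1))) * latticeConst (d + 1) (δ / 2) :=
        Finset.sum_le_sum fun y _ => mul_le_mul_of_nonneg_left (hrowδ y) (Real.exp_pos _).le
    _ = (∑ y : ↥(boxDom N), Real.exp (-(κ / 2 * supNorm (β.1 - y.1)))) * latticeConst (d + 1) (δ / 2) := by
        rw [Finset.sum_mul]
    _ ≤ latticeConst (d + 1) (κ / 2) * latticeConst (d + 1) (δ / 2) :=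
        mul_le_mul_of_nonneg_right hrowκ hKδ

/-- kernel: the one-centre estimate for NONNEGATIVE summands: `Σ_{y′}Σ_y |g||C||h| ≤ c_Ac_Cc_B·K(κ/2)K(δ/2)·e^{−ρ|β−β′|}`,
`ρ = min(κ,δ)/2`. [folklore] -/
private theorem sum2_abs_le (β β' : ↥(boxDom N)) (g h : ↥(boxDom N) → ℝ)
    (C : Matrix ↥(boxDom N) ↥(boxDom N) ℝ) {cA cC cB κ δ : ℝ} (hcA : 0 ≤ cA) (hcC : 0 ≤ cC)
    (hκ : 0 < κ) (hδ : 0 < δ)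
    (hg : ∀ y, |g y| ≤ cA * Real.exp (-(κ * supNorm (β.1 - y.1))))
    (hC : ∀ y y', |C y y'| ≤ cC * Real.exp (-(δ * supNorm (y.1 - y'.1))))
    (hh : ∀ y', |h y'| ≤ cB * Real.exp (-(κ * supNorm (β'.1 - y'.1)))) :
    ∑ y' : ↥(boxDom N), ∑ y : ↥(boxDom N), |g y| * |C y y'| * |h y'|
      ≤ cA * cC * cB * (latticeConst (d + 1) (κ / 2) * latticeConst (d + 1) (δ / 2))
        * Real.exp (-(min κ δ / 2 * supNorm (β.1 - β'.1))) := by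
  have hcB : 0 ≤ cB := by
    have h0 : 0 ≤ cB * Real.exp (-(κ * supNorm (β'.1 - β'.1))) := (abs_nonneg (h β')).trans (hh β')
    exact nonneg_of_mul_nonneg_left h0 (Real.exp_pos _)
  have hc1 : 0 ≤ cA * cC * cB * Real.exp (-(min κ δ / 2 * supNorm (β.1 - β'.1))) :=
    mul_nonneg (mul_nonneg (mul_nonneg hcA hcC) hcB) (Real.exp_pos _).le
  have s2 : ∑ y' : ↥(boxDom N), ∑ y : ↥(boxDom N), |g y| * |C y y'| * |h y'|
      ≤ ∑ y' : ↥(boxDom N), ∑ y : ↥(boxDom N), cA * cC * cB * Real.exp (-(min κ δ / 2 * supNorm (β.1 - β'.1)))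
          * (Real.exp (-(κ / 2 * supNorm (β.1 - y.1))) * Real.exp (-(δ / 2 * supNorm (y.1 - y'.1)))) := by
    refine Finset.sum_le_sum fun y' _ => Finset.sum_le_sum fun y _ => ?_
    have h := term3_le β β' y y' hcA hcC hκ hδ (hg y) (hC y y') (hh y')
    rwa [abs_mul, abs_mul] at h
  have s3 : ∑ y' : ↥(boxDom N), ∑ y : ↥(boxDom N), cA * cC * cB * Real.exp (-(min κ δ / 2 * supNorm (β.1 - β'.1)))
          * (Real.exp (-(κ / 2 * supNorm (β.1 - y.1))) * Real.exp (-(δ / 2 * supNorm (y.1 - y'.1))))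
      = cA * cC * cB * Real.exp (-(min κ δ / 2 * supNorm (β.1 - β'.1)))
          * ∑ y' : ↥(boxDom N), ∑ y : ↥(boxDom N), (Real.exp (-(κ / 2 * supNorm (β.1 - y.1)))
              * Real.exp (-(δ / 2 * supNorm (y.1 - y'.1)))) := by
    rw [Finset.mul_sum]
    refine Finset.sum_congr rfl fun y' _ => ?_
    rw [Finset.mul_sum]
  have s4 := mul_le_mul_of_nonneg_left (sum2_exp_le β hκ hδ) hc1
  calc ∑ y' : ↥(boxDom N), ∑ y : ↥(boxDom N), |g y| * |C y y'| * |h y'|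
      ≤ cA * cC * cB * Real.exp (-(min κ δ / 2 * supNorm (β.1 - β'.1)))
          * (latticeConst (d + 1) (κ / 2) * latticeConst (d + 1) (δ / 2)) := by linarith
    _ = _ := by ring

/-- kernel: **THE TWO-CENTRE POINTWISE TRIPLE-PRODUCT ESTIMATE** — if the vector `g` decays about the PAIR `{β₁, β₂}`
(`|g(y)| ≤ c_A e^{−κ·min(|β₁−y|,|β₂−y|)}`), `C` off the diagonal and `h` about `β′`, then
`|Σ_{y′}Σ_y g(y)C(y,y′)h(y′)| ≤ 2c_Ac_Cc_B·K(κ/2)K(δ/2)·e^{−(min(κ,δ)/2)·min(|β₁−β′|,|β₂−β′|)}` (split `e^{−κ min(p₁,p₂)} ≤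
e^{−κp₁} + e^{−κp₂}` and apply the one-centre estimate twice) — the pointwise twin of `B4Thm19ZeroBoxHolder.wsum2_split_le`.
[folklore] -/
private theorem abs_sum2_le2 (β₁ β₂ β' : ↥(boxDom N)) (g h : ↥(boxDom N) → ℝ)
    (C : Matrix ↥(boxDom N) ↥(boxDom N) ℝ) {cA cC cB κ δ : ℝ} (hcA : 0 ≤ cA) (hcC : 0 ≤ cC) (hcB : 0 ≤ cB)
    (hκ : 0 < κ) (hδ : 0 < δ)
    (hg : ∀ y, |g y| ≤ cA * Real.exp (-(κ * min (supNorm (β₁.1 - y.1)) (supNorm (β₂.1 - y.1)))))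
    (hC : ∀ y y', |C y y'| ≤ cC * Real.exp (-(δ * supNorm (y.1 - y'.1))))
    (hh : ∀ y', |h y'| ≤ cB * Real.exp (-(κ * supNorm (β'.1 - y'.1)))) :
    |∑ y' : ↥(boxDom N), ∑ y : ↥(boxDom N), g y * C y y' * h y'|
      ≤ 2 * (cA * cC * cB) * (latticeConst (d + 1) (κ / 2) * latticeConst (d + 1) (δ / 2))
        * Real.exp (-(min κ δ / 2 * min (supNorm (β₁.1 - β'.1)) (supNorm (β₂.1 - β'.1)))) := by
  -- the two one-centre majorants of `g`
  set g₁ : ↥(boxDom N) → ℝ := fun y => cA * Real.exp (-(κ * supNorm (β₁.1 - y.1))) with hg₁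
  set g₂ : ↥(boxDom N) → ℝ := fun y => cA * Real.exp (-(κ * supNorm (β₂.1 - y.1))) with hg₂
  have hg₁0 : ∀ y, 0 ≤ g₁ y := fun y => mul_nonneg hcA (Real.exp_pos _).le
  have hg₂0 : ∀ y, 0 ≤ g₂ y := fun y => mul_nonneg hcA (Real.exp_pos _).le
  have hsplit : ∀ y, |g y| ≤ g₁ y + g₂ y := by
    intro y
    refine (hg y).trans ?_
    simp only [hg₁, hg₂]
    rw [← mul_add]
    refine mul_le_mul_of_nonneg_left ?_ hcA
    rcases min_choice (supNorm (β₁.1 - y.1)) (supNorm (β₂.1 - y.1)) with h | h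
    · rw [h]; linarith [Real.exp_pos (-(κ * supNorm (β₂.1 - y.1)))]
    · rw [h]; linarith [Real.exp_pos (-(κ * supNorm (β₁.1 - y.1)))]
  have hb1 : ∀ y, |g₁ y| ≤ cA * Real.exp (-(κ * supNorm (β₁.1 - y.1))) := fun y => by
    rw [abs_of_nonneg (hg₁0 y)]
  have hb2 : ∀ y, |g₂ y| ≤ cA * Real.exp (-(κ * supNorm (β₂.1 - y.1))) := fun y => by
    rw [abs_of_nonneg (hg₂0 y)]
  have S1 := sum2_abs_le β₁ β' g₁ h C hcA hcC hκ hδ hb1 hC hh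
  have S2 := sum2_abs_le β₂ β' g₂ h C hcA hcC hκ hδ hb2 hC hh
  have hK : 0 ≤ cA * cC * cB * (latticeConst (d + 1) (κ / 2) * latticeConst (d + 1) (δ / 2)) :=
    mul_nonneg (mul_nonneg (mul_nonneg hcA hcC) hcB)
      (mul_nonneg (latticeConst_nonneg _ (half_pos hκ).le) (latticeConst_nonneg _ (half_pos hδ).le))
  have hE1 : Real.exp (-(min κ δ / 2 * supNorm (β₁.1 - β'.1)))
      ≤ Real.exp (-(min κ δ / 2 * min (supNorm (β₁.1 - β'.1)) (supNorm (β₂.1 - β'.1)))) :=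
    Real.exp_le_exp.2 (by
      have h0 : 0 ≤ min κ δ / 2 := by have := le_min hκ.le hδ.le; linarith
      nlinarith [min_le_left (supNorm (β₁.1 - β'.1)) (supNorm (β₂.1 - β'.1))])
  have hE2 : Real.exp (-(min κ δ / 2 * supNorm (β₂.1 - β'.1)))
      ≤ Real.exp (-(min κ δ / 2 * min (supNorm (β₁.1 - β'.1)) (supNorm (β₂.1 - β'.1)))) :=
    Real.exp_le_exp.2 (by
      have h0 : 0 ≤ min κ δ / 2 := by have := le_min hκ.le hδ.le; linarith
      nlinarith [min_le_right (supNorm (β₁.1 - β'.1)) (supNorm (β₂.1 - β'.1))])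
  calc |∑ y' : ↥(boxDom N), ∑ y : ↥(boxDom N), g y * C y y' * h y'|
      ≤ ∑ y' : ↥(boxDom N), ∑ y : ↥(boxDom N), |g y| * |C y y'| * |h y'| := by
        refine (Finset.abs_sum_le_sum_abs _ _).trans (Finset.sum_le_sum fun y' _ => ?_)
        refine (Finset.abs_sum_le_sum_abs _ _).trans (Finset.sum_le_sum fun y _ => ?_)
        rw [abs_mul, abs_mul]
    _ ≤ ∑ y' : ↥(boxDom N), ∑ y : ↥(boxDom N), (g₁ y + g₂ y) * |C y y'| * |h y'| := by
        refine Finset.sum_le_sum fun y' _ => Finset.sum_le_sum fun y _ => ?_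
        exact mul_le_mul_of_nonneg_right (mul_le_mul_of_nonneg_right (hsplit y) (abs_nonneg _)) (abs_nonneg _)
    _ = (∑ y' : ↥(boxDom N), ∑ y : ↥(boxDom N), |g₁ y| * |C y y'| * |h y'|)
          + ∑ y' : ↥(boxDom N), ∑ y : ↥(boxDom N), |g₂ y| * |C y y'| * |h y'| := by
        rw [← Finset.sum_add_distrib]
        refine Finset.sum_congr rfl fun y' _ => ?_
        rw [← Finset.sum_add_distrib]
        refine Finset.sum_congr rfl fun y _ => ?_
        rw [abs_of_nonneg (hg₁0 y), abs_of_nonneg (hg₂0 y)]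
        ring
    _ ≤ cA * cC * cB * (latticeConst (d + 1) (κ / 2) * latticeConst (d + 1) (δ / 2))
          * Real.exp (-(min κ δ / 2 * min (supNorm (β₁.1 - β'.1)) (supNorm (β₂.1 - β'.1))))
        + cA * cC * cB * (latticeConst (d + 1) (κ / 2) * latticeConst (d + 1) (δ / 2))
          * Real.exp (-(min κ δ / 2 * min (supNorm (β₁.1 - β'.1)) (supNorm (β₂.1 - β'.1)))) :=
        add_le_add (S1.trans (mul_le_mul_of_nonneg_left hE1 hK)) (S2.trans (mul_le_mul_of_nonneg_left hE2 hK))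
    _ = _ := by ring

end Pointwise

/-! ## §2 Block bookkeeping (copies of the private one-liners of `B3Ineq210ZeroBox`/`B3Ineq212ZeroBox`) -/

/-- kernel: from `n ≤ b(D + 1)`: the block-label decay `e^{−ρD}` is a fine-lattice decay `e^{ρ}·e^{−δ₁n/b}` for every
`δ₁ ≤ ρ`. [folklore] -/
private theorem exp_blk_le {ρ δ₁ n D b : ℝ} (hρ : 0 ≤ ρ) (hδρ : δ₁ ≤ ρ) (hb : 0 < b) (hn : 0 ≤ n)
    (hnD : n ≤ b * (D + 1)) :
    Real.exp (-(ρ * D)) ≤ Real.exp ρ * Real.exp (-(δ₁ * n / b)) := by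
  rw [← Real.exp_add]
  apply Real.exp_le_exp.2
  have h1 : n / b ≤ D + 1 := by rw [div_le_iff₀ hb]; linarith
  have h2 : δ₁ * n / b = δ₁ * (n / b) := by ring
  have h3 : δ₁ * (n / b) ≤ ρ * (n / b) := mul_le_mul_of_nonneg_right hδρ (div_nonneg hn hb.le)
  have h4 : ρ * (n / b) ≤ ρ * (D + 1) := mul_le_mul_of_nonneg_left h1 hρ
  rw [h2]
  linarith

/-- kernel: `min(n₁,n₂) ≤ b·(min(D₁,D₂) + 1)` from `nᵢ ≤ b(Dᵢ + 1)`. [folklore] -/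
private theorem min_le_blk {n₁ n₂ D₁ D₂ b : ℝ} (h1 : n₁ ≤ b * (D₁ + 1)) (h2 : n₂ ≤ b * (D₂ + 1)) :
    min n₁ n₂ ≤ b * (min D₁ D₂ + 1) := by
  rcases le_total D₁ D₂ with h | h
  · rw [min_eq_left h]; exact (min_le_left _ _).trans h1
  · rw [min_eq_right h]; exact (min_le_right _ _).trans h2

/-- kernel: `b_0 = L^0 = 1`. [folklore] -/
private theorem bj_zero_cast (ℓ : ℕ) : ((bj ℓ 0 : ℕ) : ℝ) = 1 := by simp [bj]

/-- kernel: `L^k = s_0`. [folklore] -/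
private theorem Lk_eq_sc_zero (ℓ k : ℕ) : ((((ℓ + 1) ^ k : ℕ)) : ℝ) = sc ℓ k 0 := by
  simp [sc]

/-- kernel: differencing an indicator-restricted row: `Σ(1_{c}a) − Σ(1_{c}b) = Σ 1_{c}(a − b)`. [folklore] -/
private theorem sum_ite_sub {ι : Type*} (s : Finset ι) (c : ι → Prop) [DecidablePred c] (f g : ι → ℝ) :
    ∑ i ∈ s, (if c i then f i else 0) - ∑ i ∈ s, (if c i then g i else 0)
      = ∑ i ∈ s, (if c i then f i - g i else 0) := by
  rw [← Finset.sum_sub_distrib]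
  refine Finset.sum_congr rfl fun i _ => ?_
  split_ifs <;> simp

/-- kernel: `η^{−n}·L^{−jn} = s_j^{n}` (`L^k = s_jb_j`). [folklore] -/
private theorem Lk_pow_mul_inv_bj_pow {ℓ k j : ℕ} (hj : j ≤ k) (n : ℕ) :
    ((((ℓ + 1) ^ k : ℕ) : ℝ)) ^ n * ((((bj ℓ j : ℕ) : ℝ)) ^ n)⁻¹ = sc ℓ k j ^ n := by
  have h := sc_mul_bj (ℓ := ℓ) hj
  rw [bj_cast] at h
  have hL : (0 : ℝ) < ((ℓ : ℝ) + 1) ^ j := by positivity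
  push_cast [bj_cast]
  rw [← h, mul_pow]
  field_simp

/-- kernel: `(s⁻¹)^{1−n−α} = s^n·(s^α·s^{−1})` (real exponent). [folklore] -/
private theorem inv_rpow_one_sub_sub {s : ℝ} (hs : 0 < s) (n : ℕ) (α : ℝ) :
    (s⁻¹) ^ ((1 : ℝ) - (n : ℝ) - α) = s ^ n * (s ^ α * s⁻¹) := by
  have hα : 0 < s ^ α := Real.rpow_pos_of_pos hs α
  rw [Real.inv_rpow hs.le, Real.rpow_sub hs, Real.rpow_sub hs, Real.rpow_one, Real.rpow_natCast]
  field_simp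

section Rows

variable {ℓ k j : ℕ} {M : Fin (d + 1) → ℕ} {a m2 : ℝ}

/-- kernel: a differenced row of `A_j = 𝒢_jQ_j^*` is the indicator-restricted differenced row of `𝒢_j`. [folklore] -/
private theorem Amat_row_sub (p q : ↥(boxDom (Nf ℓ k M))) (y : ↥(boxDom (Mj ℓ k M j))) :
    Amat ℓ k M j a m2 p y - Amat ℓ k M j a m2 q y
      = ∑ x'' : ↥(boxDom (Nf ℓ k M)),
          (if blk (bj ℓ j) x''.1 = y.1 then Gfine ℓ k M j a m2 p x'' - Gfine ℓ k M j a m2 q x'' else 0) := by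
  simp only [Amat, Matrix.mul_apply, QksM, Matrix.of_apply, mul_ite, mul_one, mul_zero]
  exact sum_ite_sub _ _ _ _

/-- kernel: the doubly differenced row of `A_j`. [folklore] -/
private theorem Amat_row_dd (p' q' p q : ↥(boxDom (Nf ℓ k M))) (y : ↥(boxDom (Mj ℓ k M j))) :
    (Amat ℓ k M j a m2 p' y - Amat ℓ k M j a m2 q' y) - (Amat ℓ k M j a m2 p y - Amat ℓ k M j a m2 q y)
      = ∑ x'' : ↥(boxDom (Nf ℓ k M)),
          (if blk (bj ℓ j) x''.1 = y.1 then
            (Gfine ℓ k M j a m2 p' x'' - Gfine ℓ k M j a m2 q' x'')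
              - (Gfine ℓ k M j a m2 p x'' - Gfine ℓ k M j a m2 q x'') else 0) := by
  rw [Amat_row_sub, Amat_row_sub]
  exact sum_ite_sub _ _ _ _

end Rows

/-! ## §3 The Hölder-weighted, doubly differenced scale pieces

For lattice neighbours `xe₁ = x₁ + e_μ`, `xe₂ = x₂ + e_μ` in `□` (`x₁ ≠ x₂`) the `η^d`-normalised quantity of (2.11) at
`A = B̃ = 0` (`U ≡ 1`) is `η^{−(d+1)}` times `L^k·|(G_{(j)}(xe₂,x) − G_{(j)}(x₂,x)) − (G_{(j)}(xe₁,x) − G_{(j)}(x₁,x))|`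
(`D^η_{0,μ} = η^{−1}·`forward difference, `η^{−1} = L^k`), and `1/|x₂−x₁|^α = (L^k/|x₂−x₁|_∞)^α` in lattice units.
For `1 ≤ j < k` the piece is `α_j²A_jC_jB_j` (`B3Ineq210ZeroBox.piece_eq_ACB`); its Hölder-weighted doubly-differenced row
is `α_j²Σ_{y′,y} g_H(y)C_j(y,y′)B_j(y′,x)` (`B4Thm19ZeroBoxHolder.weight_smul_mul3_row_dd`) with
`|g_H(y)| ≤ s_j^αs_j^{−1}C_He^{−κ·min(|βx₁−y|,|βx₂−y|)}` — the transported (2.36)/(2.38) of [B4]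
(`B4Thm19ZeroBoxHolder.Gfine_blockRowHolder_bound`) — and the two-centre estimate of §1 gives the decay in
`dist({x₁,x₂},x)`.  At `j = 0` (`L^0η = η`, nothing to gain) the four values of `𝒢_1` are bounded separately
(`(L^k/|x₂−x₁|)^α ≤ (L^k)^α = s_0^α`, `L^k·s_1^{−2} = L²s_0^{−1}`). -/

/-- kernel: the one-step box Green's function `𝒢_1 = s_1^{-2}G_1(□)` decays on the lattice scale (as in `B3Ineq210ZeroBox`,
private there). [folklore] -/
private theorem abs_Gfine_one_le (d ℓ : ℕ) (hℓ : 1 ≤ ℓ) (amin aplus m2plus : ℝ) (ha : 0 < amin) :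
    ∃ r C₀ : ℝ, 0 < r ∧ 0 < C₀ ∧ ∀ (k : ℕ), 1 ≤ k → ∀ (a m2 : ℝ), amin ≤ a → a ≤ aplus → 0 ≤ m2 →
      m2 ≤ m2plus → ∀ (M : Fin (d + 1) → ℕ), (∀ i, 1 ≤ M i) → ∀ (x x' : ↥(boxDom (Nf ℓ k M))),
        |Gfine ℓ k M 1 a m2 x x'| ≤ (sc ℓ k 1 ^ 2)⁻¹ * C₀ * Real.exp (-(r * supNorm (x.1 - x'.1))) := by
  obtain ⟨r, C₀, hr, hC₀, hdec⟩ := boxOpR_L_inv_decay d ℓ hℓ (amin * (1 - ((((ℓ : ℝ) + 1)) ^ 2)⁻¹))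
    aplus m2plus (aminus'_pos hℓ ha)
  refine ⟨r, C₀, hr, hC₀, fun k hk a m2 h1 h2 h3 h4 M hM x x' => ?_⟩
  have ha0 : 0 < a := lt_of_lt_of_le ha h1
  obtain ⟨hw1, hw2, -⟩ := aSeq_window hℓ ha h1 h2 (le_refl 1)
  rcases Nat.lt_or_ge k 2 with hk2 | hk2
  · obtain rfl : k = 1 := by omega
    have hG : Gfine ℓ 1 M 1 a m2 = (boxOpR ((ℓ + 1) ^ 1) (B1.aSeq a ((ℓ : ℝ) + 1) 1) m2 M)⁻¹ := by
      unfold Gfine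
      rw [fineOp_top]
    rw [hG, sc_self, one_pow, inv_one, one_mul]
    exact hdec ((ℓ + 1) ^ 1) (pow_one _) _ _ hw1 hw2 h3 h4 M x x'
  · have hs : 0 < sc ℓ k 1 ^ 2 := pow_pos (sc_pos ℓ k 1) 2
    have hm' : 0 ≤ m2 / sc ℓ k 1 ^ 2 := div_nonneg h3 hs.le
    have hm'' : m2 / sc ℓ k 1 ^ 2 ≤ m2plus := (div_le_self h3 (one_le_pow₀ (one_le_sc ℓ k 1))).trans h4
    rw [Gfine_apply hℓ (le_refl 1) hk2 hM ha0 h3 x x', abs_mul, abs_of_pos (inv_pos.2 hs), mul_assoc]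
    exact mul_le_mul_of_nonneg_left
      (hdec (bj ℓ 1) (pow_one _) _ _ hw1 hw2 hm' hm'' (Mj ℓ k M 1) ((ej ℓ k M 1 hk2).symm x)
        ((ej ℓ k M 1 hk2).symm x')) (inv_pos.2 hs).le

set_option maxHeartbeats 1600000 in
/-- **B3 (2.11) p. 426 [PDF 16] for the model instance `A = B̃ = 0`, `Ω = □`, PIECEWISE AND IN LATTICE UNITS** (counting
normalisation): for every `0 ≤ α < 1` there are `δ₁ = δ₁(α) > 0`, `C = C(α) > 0` (depending on `d`, `L`, the window and `α`)
such that for every `k ≥ 1`, `j < k`, every point of the window, every box, every axis `μ`, all lattice neighbours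
`xe₁ = x₁ + e_μ`, `xe₂ = x₂ + e_μ` in `□` with `x₁ ≠ x₂` and every `x`:
`(L^k/|x₂−x₁|_∞)^α · L^k·|(G_{(j)}(xe₂,x) − G_{(j)}(x₂,x)) − (G_{(j)}(xe₁,x) − G_{(j)}(x₁,x))|
≤ C·L^{−j(d+1)}·(s_j^αs_j^{−1})·e^{−δ₁·min(|x₁−x|_∞,|x₂−x|_∞)/L^j}` (`s_j = L^{k−j} = (L^jη)^{−1}`) — the printed
`O(1)(L^jη)^{−d+1−α}e^{−δ₁(L^jη)^{−1}dist({x₁,x₂},x)}` times `η^{d+1}`.  Inputs: the Hölder block-row form of [B4] (2.36)/(2.38)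
(`B4Thm19ZeroBoxHolder.Gfine_blockRowHolder_bound`), the value form of (2.35) (`B4Thm110ZeroBox.Gfine_blockRow_bound`),
(2.37) (`B4BoxCov237.cov237_box_decay`), the two-centre triple-product estimate (§1), and the one-step base bounded
crudely.  The dependence of the constants on `α` is that of the print ([B4] p. 573: «c₀ [depends] on α also») and of the
tree's (2.36) (`B4StripSumsHolder.boundGH`). [cite: Balaban1983Higgs3, (2.11) p.426] -/
theorem abs_pieceDD_le (d ℓ : ℕ) (hℓ : 1 ≤ ℓ) (amin aplus m2plus : ℝ) (ha : 0 < amin) {α : ℝ} (hα0 : 0 ≤ α)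
    (hα1 : α < 1) :
    ∃ δ₁ C : ℝ, 0 < δ₁ ∧ 0 < C ∧ ∀ (k : ℕ), 1 ≤ k → ∀ (j : ℕ), j < k → ∀ (a m2 : ℝ), amin ≤ a → a ≤ aplus →
      0 ≤ m2 → m2 ≤ m2plus → ∀ (M : Fin (d + 1) → ℕ), (∀ i, 1 ≤ M i) →
        ∀ (μ : Fin (d + 1)) (x₁ xe₁ x₂ xe₂ : ↥(boxDom (Nf ℓ k M))), xe₁.1 = x₁.1 + Pi.single μ 1 →
          xe₂.1 = x₂.1 + Pi.single μ 1 → x₂.1 ≠ x₁.1 → ∀ (x : ↥(boxDom (Nf ℓ k M))),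
          ((((ℓ + 1) ^ k : ℕ) : ℝ) / supNorm (x₂.1 - x₁.1)) ^ α *
              ((((ℓ + 1) ^ k : ℕ) : ℝ) * |(piece ℓ k M j a m2 xe₂ x - piece ℓ k M j a m2 x₂ x)
                - (piece ℓ k M j a m2 xe₁ x - piece ℓ k M j a m2 x₁ x)|)
            ≤ C * ((((bj ℓ j : ℕ) : ℝ) ^ (d + 1))⁻¹ * (sc ℓ k j ^ α * (sc ℓ k j)⁻¹))
              * Real.exp (-(δ₁ * min (supNorm (x₁.1 - x.1)) (supNorm (x₂.1 - x.1)) / ((bj ℓ j : ℕ) : ℝ))) := by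
  obtain ⟨r, C₀, hr, hC₀, hone⟩ := abs_Gfine_one_le d ℓ hℓ amin aplus m2plus ha
  obtain ⟨κ, C₁, hκ, hC₁, hR⟩ := Gfine_blockRow_bound d ℓ hℓ amin aplus m2plus ha
  obtain ⟨κ', C', hκ', hC', hRH⟩ := Gfine_blockRowHolder_bound d ℓ hℓ amin aplus m2plus ha hα0 hα1
  obtain ⟨δ, c₂, hδ, hc₂, hCov⟩ := cov237_box_decay d ℓ hℓ (amin * (1 - ((((ℓ : ℝ) + 1)) ^ 2)⁻¹)) aplus
    m2plus amin aplus (aminus'_pos hℓ ha) ha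
  have hκ₀ : 0 < min κ κ' := lt_min hκ hκ'
  have hKκ : 0 ≤ latticeConst (d + 1) (min κ κ' / 2) := latticeConst_nonneg _ (half_pos hκ₀).le
  have hKδ : 0 ≤ latticeConst (d + 1) (δ / 2) := latticeConst_nonneg _ (half_pos hδ).le
  have hρ0 : 0 < min (min κ κ') δ / 2 := half_pos (lt_min hκ₀ hδ)
  have hL : (0 : ℝ) < (ℓ : ℝ) + 1 := by positivity
  have hCmid : 0 ≤ 2 * (aplus ^ 2 * (C' * c₂ * C₁))
      * (latticeConst (d + 1) (min κ κ' / 2) * latticeConst (d + 1) (δ / 2))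
      * Real.exp (min (min κ κ') δ / 2) :=
    mul_nonneg (mul_nonneg (mul_nonneg two_pos.le (mul_nonneg (sq_nonneg _)
      (mul_nonneg (mul_nonneg hC' hc₂.le) hC₁))) (mul_nonneg hKκ hKδ)) (Real.exp_pos _).le
  have hCzero : 0 < 4 * (C₀ * Real.exp r * ((ℓ : ℝ) + 1) ^ 2) := by positivity
  refine ⟨min (min (min κ κ') δ / 2) r, 4 * (C₀ * Real.exp r * ((ℓ : ℝ) + 1) ^ 2)
      + 2 * (aplus ^ 2 * (C' * c₂ * C₁)) * (latticeConst (d + 1) (min κ κ' / 2) * latticeConst (d + 1) (δ / 2))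
        * Real.exp (min (min κ κ') δ / 2), lt_min hρ0 hr, by linarith, ?_⟩
  intro k hk j hjk a m2 h1 h2 h3 h4 M hM μ x₁ xe₁ x₂ xe₂ hxe₁ hxe₂ hne x
  have ha0 : 0 < a := lt_of_lt_of_le ha h1
  have hn1 : 0 ≤ supNorm (x₁.1 - x.1) := supNorm_nonneg _
  have hn2 : 0 ≤ supNorm (x₂.1 - x.1) := supNorm_nonneg _
  have hmn : 0 ≤ min (supNorm (x₁.1 - x.1)) (supNorm (x₂.1 - x.1)) := le_min hn1 hn2
  have hLk : (0 : ℝ) < (((ℓ + 1) ^ k : ℕ) : ℝ) := by positivity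
  -- the Hölder weight
  set W : ℝ := ((((ℓ + 1) ^ k : ℕ) : ℝ) / supNorm (x₂.1 - x₁.1)) ^ α with hW
  have hσ1 : 1 ≤ supNorm (x₂.1 - x₁.1) := one_le_supNorm (sub_ne_zero.2 hne)
  have hσ0 : 0 < supNorm (x₂.1 - x₁.1) := lt_of_lt_of_le one_pos hσ1
  have hW0 : 0 ≤ W := Real.rpow_nonneg (div_nonneg (Nat.cast_nonneg _) hσ0.le) α
  rcases Nat.eq_zero_or_pos j with rfl | hj1
  · -- `j = 0`: the four values of the one-step Green's function, the weight bounded by `(L^k)^α = s_0^α`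
    rw [piece_zero, bj_zero_cast, one_pow, inv_one, one_mul, div_one]
    have g1 := hone k hk a m2 h1 h2 h3 h4 M hM xe₂ x
    have g2 := hone k hk a m2 h1 h2 h3 h4 M hM x₂ x
    have g3 := hone k hk a m2 h1 h2 h3 h4 M hM xe₁ x
    have g4 := hone k hk a m2 h1 h2 h3 h4 M hM x₁ x
    have hs1 : 0 < sc ℓ k 1 ^ 2 := pow_pos (sc_pos ℓ k 1) 2
    have hs1i : 0 ≤ (sc ℓ k 1 ^ 2)⁻¹ := (inv_pos.2 hs1).le
    have hs0 : sc ℓ k 0 = ((ℓ : ℝ) + 1) * sc ℓ k 1 := sc_eq_succ (by omega : 0 + 1 ≤ k)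
    have hnb1 := supNorm_sub_le_nbr (x' := x.1) hxe₁
    have hnb2 := supNorm_sub_le_nbr (x' := x.1) hxe₂
    -- each of the four values is at most `(s_1²)⁻¹C₀e^{r}·e^{−r·min}`
    have hE : ∀ {t : ℝ}, min (supNorm (x₁.1 - x.1)) (supNorm (x₂.1 - x.1)) ≤ t + 1 →
        Real.exp (-(r * t)) ≤ Real.exp r * Real.exp (-(r * min (supNorm (x₁.1 - x.1)) (supNorm (x₂.1 - x.1)))) := by
      intro t ht
      rw [← Real.exp_add]
      exact Real.exp_le_exp.2 (by nlinarith)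
    have e1 := hE (t := supNorm (xe₂.1 - x.1)) (by linarith [min_le_right (supNorm (x₁.1 - x.1)) (supNorm (x₂.1 - x.1))])
    have e2 := hE (t := supNorm (x₂.1 - x.1)) (by linarith [min_le_right (supNorm (x₁.1 - x.1)) (supNorm (x₂.1 - x.1))])
    have e3 := hE (t := supNorm (xe₁.1 - x.1)) (by linarith [min_le_left (supNorm (x₁.1 - x.1)) (supNorm (x₂.1 - x.1))])
    have e4 := hE (t := supNorm (x₁.1 - x.1)) (by linarith [min_le_left (supNorm (x₁.1 - x.1)) (supNorm (x₂.1 - x.1))])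
    have hC0' : 0 ≤ (sc ℓ k 1 ^ 2)⁻¹ * C₀ := mul_nonneg hs1i hC₀.le
    have b1 := g1.trans (mul_le_mul_of_nonneg_left e1 hC0')
    have b2 := g2.trans (mul_le_mul_of_nonneg_left e2 hC0')
    have b3 := g3.trans (mul_le_mul_of_nonneg_left e3 hC0')
    have b4 := g4.trans (mul_le_mul_of_nonneg_left e4 hC0')
    have h4 : |(Gfine ℓ k M 1 a m2 xe₂ x - Gfine ℓ k M 1 a m2 x₂ x)
          - (Gfine ℓ k M 1 a m2 xe₁ x - Gfine ℓ k M 1 a m2 x₁ x)|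
        ≤ |Gfine ℓ k M 1 a m2 xe₂ x| + |Gfine ℓ k M 1 a m2 x₂ x|
          + (|Gfine ℓ k M 1 a m2 xe₁ x| + |Gfine ℓ k M 1 a m2 x₁ x|) :=
      (abs_sub _ _).trans (add_le_add (abs_sub _ _) (abs_sub _ _))
    have hWle : W ≤ sc ℓ k 0 ^ α := by
      rw [hW, ← Lk_eq_sc_zero]
      exact Real.rpow_le_rpow (div_nonneg (Nat.cast_nonneg _) hσ0.le) (div_le_self hLk.le hσ1) hα0
    have hsα : 0 ≤ sc ℓ k 0 ^ α := Real.rpow_nonneg (sc_pos ℓ k 0).le α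
    have heq : (((ℓ + 1) ^ k : ℕ) : ℝ) * (4 * ((sc ℓ k 1 ^ 2)⁻¹ * C₀ * Real.exp r))
        = 4 * (C₀ * Real.exp r * ((ℓ : ℝ) + 1) ^ 2) * (sc ℓ k 0)⁻¹ := by
      rw [Lk_eq_sc_zero, hs0]
      have := (sc_pos ℓ k 1).ne'
      field_simp
    have hs0i : 0 ≤ (sc ℓ k 0)⁻¹ := (inv_pos.2 (sc_pos ℓ k 0)).le
    have hexp : Real.exp (-(r * min (supNorm (x₁.1 - x.1)) (supNorm (x₂.1 - x.1))))
        ≤ Real.exp (-(min (min (min κ κ') δ / 2) r * min (supNorm (x₁.1 - x.1)) (supNorm (x₂.1 - x.1)))) :=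
      exp_rate_mono (min_le_right _ _) hmn
    have hin : (((ℓ + 1) ^ k : ℕ) : ℝ) * |(Gfine ℓ k M 1 a m2 xe₂ x - Gfine ℓ k M 1 a m2 x₂ x)
          - (Gfine ℓ k M 1 a m2 xe₁ x - Gfine ℓ k M 1 a m2 x₁ x)|
        ≤ 4 * (C₀ * Real.exp r * ((ℓ : ℝ) + 1) ^ 2) * (sc ℓ k 0)⁻¹
          * Real.exp (-(r * min (supNorm (x₁.1 - x.1)) (supNorm (x₂.1 - x.1)))) := by
      calc (((ℓ + 1) ^ k : ℕ) : ℝ) * |(Gfine ℓ k M 1 a m2 xe₂ x - Gfine ℓ k M 1 a m2 x₂ x)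
            - (Gfine ℓ k M 1 a m2 xe₁ x - Gfine ℓ k M 1 a m2 x₁ x)|
          ≤ (((ℓ + 1) ^ k : ℕ) : ℝ) * (4 * ((sc ℓ k 1 ^ 2)⁻¹ * C₀
              * (Real.exp r * Real.exp (-(r * min (supNorm (x₁.1 - x.1)) (supNorm (x₂.1 - x.1))))))) :=
            mul_le_mul_of_nonneg_left (h4.trans (by linarith)) hLk.le
        _ = (((ℓ + 1) ^ k : ℕ) : ℝ) * (4 * ((sc ℓ k 1 ^ 2)⁻¹ * C₀ * Real.exp r))
              * Real.exp (-(r * min (supNorm (x₁.1 - x.1)) (supNorm (x₂.1 - x.1)))) := by ring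
        _ = _ := by rw [heq]
    have hK0 : 0 ≤ 4 * (C₀ * Real.exp r * ((ℓ : ℝ) + 1) ^ 2) * (sc ℓ k 0)⁻¹
        * Real.exp (-(r * min (supNorm (x₁.1 - x.1)) (supNorm (x₂.1 - x.1)))) := by positivity
    calc W * ((((ℓ + 1) ^ k : ℕ) : ℝ) * |(Gfine ℓ k M 1 a m2 xe₂ x - Gfine ℓ k M 1 a m2 x₂ x)
            - (Gfine ℓ k M 1 a m2 xe₁ x - Gfine ℓ k M 1 a m2 x₁ x)|)
        ≤ sc ℓ k 0 ^ α * (4 * (C₀ * Real.exp r * ((ℓ : ℝ) + 1) ^ 2) * (sc ℓ k 0)⁻¹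
            * Real.exp (-(r * min (supNorm (x₁.1 - x.1)) (supNorm (x₂.1 - x.1))))) :=
          mul_le_mul hWle hin (mul_nonneg hLk.le (abs_nonneg _)) hsα
      _ = 4 * (C₀ * Real.exp r * ((ℓ : ℝ) + 1) ^ 2) * (sc ℓ k 0 ^ α * (sc ℓ k 0)⁻¹)
            * Real.exp (-(r * min (supNorm (x₁.1 - x.1)) (supNorm (x₂.1 - x.1)))) := by ring
      _ ≤ 4 * (C₀ * Real.exp r * ((ℓ : ℝ) + 1) ^ 2) * (sc ℓ k 0 ^ α * (sc ℓ k 0)⁻¹)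
            * Real.exp (-(min (min (min κ κ') δ / 2) r * min (supNorm (x₁.1 - x.1)) (supNorm (x₂.1 - x.1)))) :=
          mul_le_mul_of_nonneg_left hexp (by positivity)
      _ ≤ _ := by
          refine mul_le_mul_of_nonneg_right (mul_le_mul_of_nonneg_right (by linarith) (mul_nonneg hsα hs0i))
            (Real.exp_pos _).le
  · -- `1 ≤ j ≤ k − 1`: the Hölder-weighted doubly differenced `α_j²·A_jC_jB_j`
    have hj : j + 1 ≤ k := by omega
    obtain ⟨hw1, hw2, hapos⟩ := aSeq_window hℓ ha h1 h2 hj1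
    have hs : 0 < sc ℓ k j ^ 2 := pow_pos (sc_pos ℓ k j) 2
    have hsi : 0 < (sc ℓ k j ^ 2)⁻¹ := inv_pos.2 hs
    have hs1i : 0 < (sc ℓ k j)⁻¹ := inv_pos.2 (sc_pos ℓ k j)
    have hsα : 0 ≤ sc ℓ k j ^ α := Real.rpow_nonneg (sc_pos ℓ k j).le α
    have hsc0 : sc ℓ k j ≠ 0 := (sc_pos ℓ k j).ne'
    have hm' : 0 ≤ m2 / sc ℓ k j ^ 2 := div_nonneg h3 hs.le
    have hm'' : m2 / sc ℓ k j ^ 2 ≤ m2plus := (div_le_self h3 (one_le_pow₀ (one_le_sc ℓ k j))).trans h4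
    have hb1 : 1 ≤ bj ℓ j := bj_pos ℓ j
    have hbR : (0 : ℝ) < ((bj ℓ j : ℕ) : ℝ) := by positivity
    have hbD : (0 : ℝ) < ((bj ℓ j : ℕ) : ℝ) ^ (d + 1) := by positivity
    -- the Hölder-weighted doubly differenced row of `A_j`, scaled by `L^k`
    have hg : ∀ (y : ↥(boxDom (Mj ℓ k M j))),
        |W * ((((ℓ + 1) ^ k : ℕ) : ℝ) * ((Amat ℓ k M j a m2 xe₂ y - Amat ℓ k M j a m2 x₂ y)
            - (Amat ℓ k M j a m2 xe₁ y - Amat ℓ k M j a m2 x₁ y)))|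
          ≤ sc ℓ k j ^ α * (sc ℓ k j)⁻¹ * C'
            * Real.exp (-(min κ κ' * min (supNorm (blk (bj ℓ j) x₁.1 - y.1)) (supNorm (blk (bj ℓ j) x₂.1 - y.1)))) := by
      intro y
      rw [Amat_row_dd, abs_mul, abs_of_nonneg hW0]
      refine (hRH k j hj1 hj a m2 h1 h2 h3 h4 M hM μ x₁ xe₁ x₂ xe₂ hxe₁ hxe₂ hne y.1 y.2).trans ?_
      exact mul_le_mul_of_nonneg_left
        (exp_rate_mono (min_le_right κ κ') (le_min (supNorm_nonneg _) (supNorm_nonneg _)))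
        (mul_nonneg (mul_nonneg hsα hs1i.le) hC')
    have hB : ∀ (y' : ↥(boxDom (Mj ℓ k M j))),
        |Bmat ℓ k M j a m2 y' x| ≤ ((((bj ℓ j : ℕ) : ℝ)) ^ (d + 1))⁻¹ * ((sc ℓ k j ^ 2)⁻¹ * C₁)
          * Real.exp (-(min κ κ' * supNorm (blk (bj ℓ j) x.1 - y'.1))) := by
      intro y'
      have hBe : Bmat ℓ k M j a m2 y' x = ((((bj ℓ j : ℕ) : ℝ)) ^ (d + 1))⁻¹ *
          ∑ w, (if blk (bj ℓ j) w.1 = y'.1 then Gfine ℓ k M j a m2 x w else 0) := by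
        simp only [Bmat, Matrix.mul_apply, QkM, Matrix.of_apply, Finset.mul_sum]
        refine Finset.sum_congr rfl fun w _ => ?_
        split_ifs with hw
        · rw [(Gfine_isSymm ℓ k M j a m2).apply x w]
        · rw [zero_mul, mul_zero]
      rw [hBe, abs_mul, abs_of_pos (inv_pos.2 hbD), mul_assoc]
      refine mul_le_mul_of_nonneg_left ((hR k j hj1 hj a m2 h1 h2 h3 h4 M hM x y'.1 y'.2).trans ?_)
        (inv_pos.2 hbD).le
      exact mul_le_mul_of_nonneg_left (exp_rate_mono (min_le_left κ κ') (supNorm_nonneg _))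
        (mul_nonneg hsi.le hC₁)
    have hC : ∀ (y y' : ↥(boxDom (Mj ℓ k M j))),
        |Cmat ℓ k M j a m2 y y'| ≤ (sc ℓ k j ^ 2)⁻¹ * c₂ * Real.exp (-(δ * supNorm (y.1 - y'.1))) := by
      intro y y'
      have h := (hCov (bj ℓ j) hb1 _ _ a hw1 hw2 hm' hm'' h1 h2 (Mp ℓ k M j) (Mp_pos hM)).2 y y'
      rw [Cmat, Matrix.smul_apply, smul_eq_mul, abs_mul, abs_of_pos hsi, mul_assoc]
      exact mul_le_mul_of_nonneg_left h hsi.le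
    -- the two-centre triple-product estimate for the weighted doubly differenced row
    have key := abs_sum2_le2 (N := Mj ℓ k M j) ⟨blk (bj ℓ j) x₁.1, blk_bj_mem hj M x₁⟩
      ⟨blk (bj ℓ j) x₂.1, blk_bj_mem hj M x₂⟩ ⟨blk (bj ℓ j) x.1, blk_bj_mem hj M x⟩
      (fun y => W * ((((ℓ + 1) ^ k : ℕ) : ℝ) * ((Amat ℓ k M j a m2 xe₂ y - Amat ℓ k M j a m2 x₂ y)
        - (Amat ℓ k M j a m2 xe₁ y - Amat ℓ k M j a m2 x₁ y))))
      (fun y' => Bmat ℓ k M j a m2 y' x) (Cmat ℓ k M j a m2) (mul_nonneg (mul_nonneg hsα hs1i.le) hC')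
      (mul_nonneg hsi.le hc₂.le) (mul_nonneg (inv_pos.2 hbD).le (mul_nonneg hsi.le hC₁)) hκ₀ hδ hg hC hB
    have hα : αj a ℓ k j ^ 2 ≤ aplus ^ 2 * (sc ℓ k j ^ 2) ^ 2 := by
      unfold αj
      rw [mul_pow]
      exact mul_le_mul_of_nonneg_right (pow_le_pow_left₀ hapos.le hw2 2) (by positivity)
    have hE := exp_blk_le (δ₁ := min (min (min κ κ') δ / 2) r) hρ0.le (min_le_left _ _) hbR hmn
      (min_le_blk (supNorm_sub_le_blk hb1 x₁.1 x.1) (supNorm_sub_le_blk hb1 x₂.1 x.1))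
    have hP0 : 0 ≤ 2 * (sc ℓ k j ^ α * (sc ℓ k j)⁻¹ * C' * ((sc ℓ k j ^ 2)⁻¹ * c₂)
        * (((((bj ℓ j : ℕ) : ℝ)) ^ (d + 1))⁻¹ * ((sc ℓ k j ^ 2)⁻¹ * C₁)))
        * (latticeConst (d + 1) (min κ κ' / 2) * latticeConst (d + 1) (δ / 2)) :=
      mul_nonneg (mul_nonneg two_pos.le (mul_nonneg (mul_nonneg (mul_nonneg (mul_nonneg hsα hs1i.le) hC')
        (mul_nonneg hsi.le hc₂.le)) (mul_nonneg (inv_pos.2 hbD).le (mul_nonneg hsi.le hC₁)))) (mul_nonneg hKκ hKδ)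
    have hsplit : W * ((((ℓ + 1) ^ k : ℕ) : ℝ) * |(piece ℓ k M j a m2 xe₂ x - piece ℓ k M j a m2 x₂ x)
          - (piece ℓ k M j a m2 xe₁ x - piece ℓ k M j a m2 x₁ x)|)
        = αj a ℓ k j ^ 2 * |∑ y' : ↥(boxDom (Mj ℓ k M j)), ∑ y : ↥(boxDom (Mj ℓ k M j)),
            W * ((((ℓ + 1) ^ k : ℕ) : ℝ) * ((Amat ℓ k M j a m2 xe₂ y - Amat ℓ k M j a m2 x₂ y)
              - (Amat ℓ k M j a m2 xe₁ y - Amat ℓ k M j a m2 x₁ y)))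
              * Cmat ℓ k M j a m2 y y' * Bmat ℓ k M j a m2 y' x| := by
      have h1 : W * ((((ℓ + 1) ^ k : ℕ) : ℝ) * |(piece ℓ k M j a m2 xe₂ x - piece ℓ k M j a m2 x₂ x)
            - (piece ℓ k M j a m2 xe₁ x - piece ℓ k M j a m2 x₁ x)|)
          = |W * ((((ℓ + 1) ^ k : ℕ) : ℝ) * ((piece ℓ k M j a m2 xe₂ x - piece ℓ k M j a m2 x₂ x)
            - (piece ℓ k M j a m2 xe₁ x - piece ℓ k M j a m2 x₁ x)))| := by
        rw [abs_mul, abs_mul, abs_of_nonneg hW0, abs_of_pos hLk]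
      rw [h1, piece_eq_ACB hℓ hj1 hj hM ha0 h3, weight_smul_mul3_row_dd, abs_mul, abs_of_nonneg (sq_nonneg _)]
    rw [hsplit]
    calc αj a ℓ k j ^ 2 * |∑ y' : ↥(boxDom (Mj ℓ k M j)), ∑ y : ↥(boxDom (Mj ℓ k M j)),
            W * ((((ℓ + 1) ^ k : ℕ) : ℝ) * ((Amat ℓ k M j a m2 xe₂ y - Amat ℓ k M j a m2 x₂ y)
              - (Amat ℓ k M j a m2 xe₁ y - Amat ℓ k M j a m2 x₁ y)))
              * Cmat ℓ k M j a m2 y y' * Bmat ℓ k M j a m2 y' x|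
        ≤ (aplus ^ 2 * (sc ℓ k j ^ 2) ^ 2) *
            (2 * (sc ℓ k j ^ α * (sc ℓ k j)⁻¹ * C' * ((sc ℓ k j ^ 2)⁻¹ * c₂)
              * (((((bj ℓ j : ℕ) : ℝ)) ^ (d + 1))⁻¹ * ((sc ℓ k j ^ 2)⁻¹ * C₁)))
              * (latticeConst (d + 1) (min κ κ' / 2) * latticeConst (d + 1) (δ / 2))
              * (Real.exp (min (min κ κ') δ / 2)
                  * Real.exp (-(min (min (min κ κ') δ / 2) r
                      * min (supNorm (x₁.1 - x.1)) (supNorm (x₂.1 - x.1)) / ((bj ℓ j : ℕ) : ℝ))))) :=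
          mul_le_mul hα (key.trans (mul_le_mul_of_nonneg_left hE hP0)) (abs_nonneg _) (by positivity)
      _ = 2 * (aplus ^ 2 * (C' * c₂ * C₁)) * (latticeConst (d + 1) (min κ κ' / 2) * latticeConst (d + 1) (δ / 2))
            * Real.exp (min (min κ κ') δ / 2)
            * ((((bj ℓ j : ℕ) : ℝ) ^ (d + 1))⁻¹ * (sc ℓ k j ^ α * (sc ℓ k j)⁻¹))
            * Real.exp (-(min (min (min κ κ') δ / 2) r
                * min (supNorm (x₁.1 - x.1)) (supNorm (x₂.1 - x.1)) / ((bj ℓ j : ℕ) : ℝ))) := by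
          field_simp
      _ ≤ _ := by
          refine mul_le_mul_of_nonneg_right (mul_le_mul_of_nonneg_right (by linarith) ?_) (Real.exp_pos _).le
          exact mul_nonneg (inv_pos.2 hbD).le (mul_nonneg hsα hs1i.le)


/-! ## §4 The carrier with the (2.11) fields modelled, `Ineq210`/`Ineq212` carried over, and (2.11) DISCHARGED per `α` -/

/-- **The concrete carrier of B3 (2.5)/(2.10)–(2.12) for the MODEL INSTANCE `A = B̃ = 0`, `Ω = □ = Π_μ[0,M_μ)`** at scale `k`
(`η = L^{−k}`, `L = ℓ + 1`): all fields of `B3Ineq212ZeroBox.zeroBoxKernelsV` (sites = the fine box in lattice units,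
`dist = η|·|_∞`, bonds, `distBlock`, the (2.10) kernels `absG`/`absDG` and the (2.12) kernel `absGavg` in the print's
`η^d`-normalisation), and IN ADDITION the (2.11) fields: `dist2 x₁ x₂ x = η·min(|x₁−x|_∞, |x₂−x|_∞)` (= `dist({x₁,x₂},x)`) and
`holderDiff j μ x₁ x₂ x = |U(B̃(Γ_{x₁,x₂}))(D^η_{B̃,μ}G^η_{(j)})(x₂,x) − (D^η_{B̃,μ}G^η_{(j)})(x₁,x)|` at `B̃ = 0` (`U ≡ 1`,
`D^η_{0,μ} = η^{−1}·`forward difference along the bonds `⟨xᵢ, xᵢ+ηe_μ⟩`) `= η^{−(d+1)}·η^{−1}·|(G_{(j)}(x₂+e_μ,x) − G_{(j)}(x₂,x))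
− (G_{(j)}(x₁+e_μ,x) − G_{(j)}(x₁,x))|` when both bonds lie in `□` (Neumann: only bonds `b ⊂ Ω` carry a derivative), `0`
otherwise.  DECLARED DIVERGENCE (F7): the (2.5) fields (`LocFn`, `distSupp`, `distΩ₂`, `eRun`, `pRun`, `normDeltaG`,
`norm116`) stay NOT MODELLED (`Unit`/`0`); nothing is claimed about `Ineq25` of this instance.
[cite: Balaban1983Higgs3, (2.6) p.424, (2.10)–(2.12) p.426] -/
def zeroBoxKernelsH (ℓ k : ℕ) (hℓ : 1 ≤ ℓ) (M : Fin (d + 1) → ℕ) (a m2 : ℝ) : ScaledKernels where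
  Site := ↥(boxDom (Nf ℓ k M))
  Bond := ↥(boxDom (Nf ℓ k M)) × Fin (d + 1)
  Dir := Fin (d + 1)
  LocFn := Unit
  dist x x' := supNorm (x.1 - x'.1) / (((ℓ + 1) ^ k : ℕ) : ℝ)
  dist2 x₁ x₂ x := min (supNorm (x₁.1 - x.1)) (supNorm (x₂.1 - x.1)) / (((ℓ + 1) ^ k : ℕ) : ℝ)
  distBlock j x b := distBlockLat ℓ k M j x b / (((ℓ + 1) ^ k : ℕ) : ℝ)
  distSupp _ _ := 0
  distΩ₂ := 0
  L := (ℓ : ℝ) + 1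
  η := ((((ℓ + 1) ^ k : ℕ) : ℝ))⁻¹
  d := d + 1
  eRun := 0
  pRun := 0
  one_lt_L := one_lt_L_real hℓ
  η_pos := inv_pos.2 (by positivity)
  absG j x x' := ((((ℓ + 1) ^ k : ℕ) : ℝ)) ^ (d + 1) * |piece ℓ k M j a m2 x x'|
  absDG j μ x x' :=
    if h : x.1 + Pi.single μ 1 ∈ boxDom (Nf ℓ k M) then
      ((((ℓ + 1) ^ k : ℕ) : ℝ)) ^ (d + 1)
        * (((((ℓ + 1) ^ k : ℕ) : ℝ)) * |piece ℓ k M j a m2 ⟨x.1 + Pi.single μ 1, h⟩ x' - piece ℓ k M j a m2 x x'|)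
    else 0
  holderDiff j μ x₁ x₂ x :=
    if h : x₁.1 + Pi.single μ 1 ∈ boxDom (Nf ℓ k M) ∧ x₂.1 + Pi.single μ 1 ∈ boxDom (Nf ℓ k M) then
      ((((ℓ + 1) ^ k : ℕ) : ℝ)) ^ (d + 1)
        * (((((ℓ + 1) ^ k : ℕ) : ℝ))
          * |(piece ℓ k M j a m2 ⟨x₂.1 + Pi.single μ 1, h.2⟩ x - piece ℓ k M j a m2 x₂ x)
              - (piece ℓ k M j a m2 ⟨x₁.1 + Pi.single μ 1, h.1⟩ x - piece ℓ k M j a m2 x₁ x)|)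
    else 0
  absGavg j x b := ((((ℓ + 1) ^ k : ℕ) : ℝ)) ^ (d + 1) * (((((ℓ + 1) ^ k : ℕ) : ℝ))⁻¹ * |gsum ℓ k M j a m2 x b|)
  normDeltaG _ _ _ := 0
  norm116 _ _ _ _ _ := 0

section CarrierH

variable {ℓ k : ℕ} {hℓ : 1 ≤ ℓ} {M : Fin (d + 1) → ℕ} {a m2 : ℝ}

/-- the length scale `L^jη = s_j^{-1}` of the carrier (`j ≤ k`). [cite: Balaban1983Higgs3, (2.11) p.426] -/
theorem scaleH_eq {j : ℕ} (hj : j ≤ k) : (zeroBoxKernelsH ℓ k hℓ M a m2).scale j = (sc ℓ k j)⁻¹ :=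
  scale_eq (hℓ := hℓ) (M := M) (a := a) (m2 := m2) hj

/-- the length scales of the carrier are positive. [cite: Balaban1983Higgs3, (2.11) p.426] -/
theorem scaleH_pos (j : ℕ) : 0 < (zeroBoxKernelsH ℓ k hℓ M a m2).scale j :=
  scale_pos (hℓ := hℓ) (M := M) (a := a) (m2 := m2) j

/-- `(L^jη)^{-1}·dist({x₁,x₂},x) = min(|x₁−x|_∞,|x₂−x|_∞)/L^j` (lattice units). [cite: Balaban1983Higgs3, (2.11) p.426] -/
theorem scaleH_inv_mul_dist2 {j : ℕ} (hj : j ≤ k) (x₁ x₂ x : ↥(boxDom (Nf ℓ k M))) :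
    ((zeroBoxKernelsH ℓ k hℓ M a m2).scale j)⁻¹ * (zeroBoxKernelsH ℓ k hℓ M a m2).dist2 x₁ x₂ x
      = min (supNorm (x₁.1 - x.1)) (supNorm (x₂.1 - x.1)) / ((bj ℓ j : ℕ) : ℝ) := by
  rw [scaleH_eq hj, inv_inv]
  show sc ℓ k j * (min (supNorm (x₁.1 - x.1)) (supNorm (x₂.1 - x.1)) / (((ℓ + 1) ^ k : ℕ) : ℝ))
    = min (supNorm (x₁.1 - x.1)) (supNorm (x₂.1 - x.1)) / ((bj ℓ j : ℕ) : ℝ)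
  have h := sc_mul_bj (ℓ := ℓ) hj
  rw [bj_cast] at h
  have hs := (sc_pos ℓ k j).ne'
  have hL : (0 : ℝ) < ((ℓ : ℝ) + 1) ^ j := by positivity
  push_cast [bj_cast]
  rw [← h]
  field_simp

/-- the Hölder weight `1/dist(x₁,x₂)^α = (L^k/|x₂−x₁|_∞)^α` (lattice units). [cite: Balaban1983Higgs3, (2.11) p.426] -/
theorem distH_rpow_inv (x₁ x₂ : ↥(boxDom (Nf ℓ k M))) (α : ℝ) :
    ((zeroBoxKernelsH ℓ k hℓ M a m2).dist x₁ x₂ ^ α)⁻¹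
      = ((((ℓ + 1) ^ k : ℕ) : ℝ) / supNorm (x₂.1 - x₁.1)) ^ α := by
  show ((supNorm (x₁.1 - x₂.1) / (((ℓ + 1) ^ k : ℕ) : ℝ)) ^ α)⁻¹ = _
  rw [← Real.inv_rpow (div_nonneg (supNorm_nonneg _) (Nat.cast_nonneg _)), inv_div,
    ← B4TorusKernel.supNorm_neg, neg_sub]

end CarrierH

/-- **(2.10) for the carrier**: `Ineq210 δ₁ C` of `zeroBoxKernelsH` IS `Ineq210 δ₁ C` of `B3Ineq210ZeroBox.zeroBoxKernels` (the
(2.10) fields coincide), discharged by `B3Ineq210ZeroBox.ineq210_zeroBox`. [cite: Balaban1983Higgs3, (2.10) p.426] -/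
theorem ineq210_zeroBoxH (d ℓ : ℕ) (hℓ : 1 ≤ ℓ) (amin aplus m2plus : ℝ) (ha : 0 < amin) :
    ∃ δ₁ C : ℝ, 0 < δ₁ ∧ 0 < C ∧ ∀ (k : ℕ), 1 ≤ k → ∀ (a m2 : ℝ), amin ≤ a → a ≤ aplus → 0 ≤ m2 →
      m2 ≤ m2plus → ∀ (M : Fin (d + 1) → ℕ), (∀ i, 1 ≤ M i) →
        (zeroBoxKernelsH ℓ k hℓ M a m2).Ineq210 δ₁ C := by
  obtain ⟨δ₁, C, hδ, hC, h⟩ := ineq210_zeroBox d ℓ hℓ amin aplus m2plus ha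
  exact ⟨δ₁, C, hδ, hC, fun k hk a m2 h1 h2 h3 h4 M hM => h k hk a m2 h1 h2 h3 h4 M hM⟩

/-- **(2.12) for the carrier**: `Ineq212 δ₁ C` of `zeroBoxKernelsH` IS `Ineq212 δ₁ C` of `B3Ineq212ZeroBox.zeroBoxKernelsV`
(the (2.12) fields coincide), discharged by `B3Ineq212ZeroBox.ineq212_zeroBoxV`. [cite: Balaban1983Higgs3, (2.12) p.426] -/
theorem ineq212_zeroBoxH (d ℓ : ℕ) (hℓ : 1 ≤ ℓ) (amin aplus m2plus : ℝ) (ha : 0 < amin) :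
    ∃ δ₁ C : ℝ, 0 < δ₁ ∧ 0 < C ∧ ∀ (k : ℕ), 1 ≤ k → ∀ (a m2 : ℝ), amin ≤ a → a ≤ aplus → 0 ≤ m2 →
      m2 ≤ m2plus → ∀ (M : Fin (d + 1) → ℕ), (∀ i, 1 ≤ M i) →
        (zeroBoxKernelsH ℓ k hℓ M a m2).Ineq212 δ₁ C := by
  obtain ⟨δ₁, C, hδ, hC, h⟩ := ineq212_zeroBoxV d ℓ hℓ amin aplus m2plus ha
  exact ⟨δ₁, C, hδ, hC, fun k hk a m2 h1 h2 h3 h4 M hM => h k hk a m2 h1 h2 h3 h4 M hM⟩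

/-- **B3 (2.11) p. 426 [PDF 16] — DISCHARGED, FOR EACH `0 ≤ α < 1`, for the model instance `A = B̃ = 0`, `Ω = □`.**  Verbatim:
*"This applies also to Hölder norms, e.g. we have
(1/|x₂−x₁|^α)|U(B̃(Γ_{x₁,x₂}))(D^η_{B̃,μ}G^η_{(j)})(Ω,B̃;x₂,x) − (D^η_{B̃,μ}G^η_{(j)})(Ω,B̃;x₁,x)| ≤
O(1)(L^jη)^{−d+1−α}e^{−δ₁(L^jη)^{−1}dist({x₁,x₂},x)}, 0 ≤ α < 1. (2.11)"*  HERE: for every `0 ≤ α < 1` there are `δ₁ > 0`, `C > 0`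
depending only on `d + 1`, `L = ℓ + 1`, the window `[a₋,a₊] × [0,m²₊]` AND `α` such that for EVERY scale `k ≥ 1`, every `(a, m²)` in
the window and every box `□ = Π_μ[0,M_μ)`, the carrier `zeroBoxKernelsH` satisfies the (2.11) inequality at this `α`:
`holderDiff j μ x₁ x₂ x / dist(x₁,x₂)^α ≤ C·(L^jη)^{1−(d+1)−α}·e^{−δ₁(L^jη)^{−1}dist2 x₁ x₂ x}` for all `j`, `μ`, `x₁ ≠ x₂`, `x` — i.e.
the body of `ScaledKernels.Ineq211 δ₁ C` with the quantifier `∀ α` moved OUTSIDE `∃ δ₁ C`.  QUANTIFIER NOTE (recorded as a gap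
for the owner of the typed statement): `ScaledKernels.Ineq211 δ₁ C` as typed asks for ONE pair `(δ₁, C)` serving all
`α ∈ [0,1)`; the print's O(1) at (2.11) is the constant of Propositions I.2.1/I.2.3 = [B4] Theorem 1.1′/(1.10), which [B4] p. 573
states to depend «on α also», and the tree's kernel form of [B4] (2.36) (`B4StripSumsHolder.boundGH`, `∝ ζ(1+(1−α)/(d+1))^{d+1}`)
is unbounded as `α → 1`; so what is discharged here is the per-`α` reading, uniformly in everything else.  HONEST SCOPE: as
`B3Ineq210ZeroBox.ineq210_zeroBox` — `A = B̃ = 0` (so `U ≡ 1`), `Ω = □` a box of unit blocks (Neumann), forward differences in the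
row variable along bonds of `□`, sup norm, existential constants; ROUTE = the print's («rescaling … Propositions I.2.1 and
I.2.3» = [B4] (2.36)–(2.39)), through the kernel-proved `A = 0` box forms (`abs_pieceDD_le`). [cite: Balaban1983Higgs3, (2.11) p.426] -/
theorem ineq211At_zeroBoxH (d ℓ : ℕ) (hℓ : 1 ≤ ℓ) (amin aplus m2plus : ℝ) (ha : 0 < amin) {α : ℝ} (hα0 : 0 ≤ α)
    (hα1 : α < 1) :
    ∃ δ₁ C : ℝ, 0 < δ₁ ∧ 0 < C ∧ ∀ (k : ℕ), 1 ≤ k → ∀ (a m2 : ℝ), amin ≤ a → a ≤ aplus → 0 ≤ m2 →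
      m2 ≤ m2plus → ∀ (M : Fin (d + 1) → ℕ), (∀ i, 1 ≤ M i) →
        ∀ (j : ℕ) (μ : (zeroBoxKernelsH ℓ k hℓ M a m2).Dir) (x₁ x₂ x : (zeroBoxKernelsH ℓ k hℓ M a m2).Site), x₁ ≠ x₂ →
          (zeroBoxKernelsH ℓ k hℓ M a m2).holderDiff j μ x₁ x₂ x / (zeroBoxKernelsH ℓ k hℓ M a m2).dist x₁ x₂ ^ α ≤
            C * (zeroBoxKernelsH ℓ k hℓ M a m2).scale j ^ (1 - ((zeroBoxKernelsH ℓ k hℓ M a m2).d : ℝ) - α)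
              * Real.exp (-(δ₁ * ((zeroBoxKernelsH ℓ k hℓ M a m2).scale j)⁻¹
                  * (zeroBoxKernelsH ℓ k hℓ M a m2).dist2 x₁ x₂ x)) := by
  obtain ⟨δ₁, C, hδ, hC, hDD⟩ := abs_pieceDD_le d ℓ hℓ amin aplus m2plus ha hα0 hα1
  refine ⟨δ₁, C, hδ, hC, ?_⟩
  intro k hk a m2 h1 h2 h3 h4 M hM j μ x₁ x₂ x hne
  change ↥(boxDom (Nf ℓ k M)) at x₁ x₂ x
  change Fin (d + 1) at μ
  have hne' : x₂.1 ≠ x₁.1 := fun h => hne (Subtype.ext h.symm)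
  have hLk : (0 : ℝ) < (((ℓ + 1) ^ k : ℕ) : ℝ) := by positivity
  have hsp : 0 < (zeroBoxKernelsH ℓ k hℓ M a m2).scale j := scaleH_pos j
  have hSd : ((zeroBoxKernelsH ℓ k hℓ M a m2).d : ℝ) = ((d + 1 : ℕ) : ℝ) := rfl
  have hRHS : 0 ≤ C * (zeroBoxKernelsH ℓ k hℓ M a m2).scale j ^ (1 - ((zeroBoxKernelsH ℓ k hℓ M a m2).d : ℝ) - α)
      * Real.exp (-(δ₁ * ((zeroBoxKernelsH ℓ k hℓ M a m2).scale j)⁻¹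
          * (zeroBoxKernelsH ℓ k hℓ M a m2).dist2 x₁ x₂ x)) :=
    mul_nonneg (mul_nonneg hC.le (Real.rpow_pos_of_pos hsp _).le) (Real.exp_pos _).le
  have hW0 : 0 ≤ ((((ℓ + 1) ^ k : ℕ) : ℝ) / supNorm (x₂.1 - x₁.1)) ^ α :=
    Real.rpow_nonneg (div_nonneg (Nat.cast_nonneg _) (supNorm_nonneg _)) α
  rw [div_eq_mul_inv, distH_rpow_inv]
  by_cases hmem : x₁.1 + Pi.single μ 1 ∈ boxDom (Nf ℓ k M) ∧ x₂.1 + Pi.single μ 1 ∈ boxDom (Nf ℓ k M)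
  · show (if h : x₁.1 + Pi.single μ 1 ∈ boxDom (Nf ℓ k M) ∧ x₂.1 + Pi.single μ 1 ∈ boxDom (Nf ℓ k M) then
        ((((ℓ + 1) ^ k : ℕ) : ℝ)) ^ (d + 1)
          * (((((ℓ + 1) ^ k : ℕ) : ℝ))
            * |(piece ℓ k M j a m2 ⟨x₂.1 + Pi.single μ 1, h.2⟩ x - piece ℓ k M j a m2 x₂ x)
                - (piece ℓ k M j a m2 ⟨x₁.1 + Pi.single μ 1, h.1⟩ x - piece ℓ k M j a m2 x₁ x)|)
        else 0) * ((((ℓ + 1) ^ k : ℕ) : ℝ) / supNorm (x₂.1 - x₁.1)) ^ α ≤ _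
    rw [dif_pos hmem]
    rcases Nat.lt_or_ge j k with hjk | hkj
    · have hj : j ≤ k := hjk.le
      have hb : (0 : ℝ) < ((bj ℓ j : ℕ) : ℝ) := by have := bj_pos ℓ j; positivity
      have hs := sc_pos ℓ k j
      have hd := hDD k hk j hjk a m2 h1 h2 h3 h4 M hM μ x₁ ⟨x₁.1 + Pi.single μ 1, hmem.1⟩ x₂
        ⟨x₂.1 + Pi.single μ 1, hmem.2⟩ rfl rfl hne' x
      have hexp : Real.exp (-(δ₁ * ((zeroBoxKernelsH ℓ k hℓ M a m2).scale j)⁻¹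
            * (zeroBoxKernelsH ℓ k hℓ M a m2).dist2 x₁ x₂ x))
          = Real.exp (-(δ₁ * min (supNorm (x₁.1 - x.1)) (supNorm (x₂.1 - x.1)) / ((bj ℓ j : ℕ) : ℝ))) := by
        rw [mul_assoc, scaleH_inv_mul_dist2 hj, mul_div_assoc]
      have hpow : (zeroBoxKernelsH ℓ k hℓ M a m2).scale j ^ (1 - ((zeroBoxKernelsH ℓ k hℓ M a m2).d : ℝ) - α)
          = sc ℓ k j ^ (d + 1) * (sc ℓ k j ^ α * (sc ℓ k j)⁻¹) := by
        rw [scaleH_eq hj, hSd, inv_rpow_one_sub_sub hs]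
      rw [hexp, hpow]
      calc ((((ℓ + 1) ^ k : ℕ) : ℝ)) ^ (d + 1)
            * (((((ℓ + 1) ^ k : ℕ) : ℝ))
              * |(piece ℓ k M j a m2 ⟨x₂.1 + Pi.single μ 1, hmem.2⟩ x - piece ℓ k M j a m2 x₂ x)
                  - (piece ℓ k M j a m2 ⟨x₁.1 + Pi.single μ 1, hmem.1⟩ x - piece ℓ k M j a m2 x₁ x)|)
            * ((((ℓ + 1) ^ k : ℕ) : ℝ) / supNorm (x₂.1 - x₁.1)) ^ α
          = ((((ℓ + 1) ^ k : ℕ) : ℝ)) ^ (d + 1)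
            * (((((ℓ + 1) ^ k : ℕ) : ℝ) / supNorm (x₂.1 - x₁.1)) ^ α
              * (((((ℓ + 1) ^ k : ℕ) : ℝ))
                * |(piece ℓ k M j a m2 ⟨x₂.1 + Pi.single μ 1, hmem.2⟩ x - piece ℓ k M j a m2 x₂ x)
                    - (piece ℓ k M j a m2 ⟨x₁.1 + Pi.single μ 1, hmem.1⟩ x - piece ℓ k M j a m2 x₁ x)|)) := by
            ring
        _ ≤ ((((ℓ + 1) ^ k : ℕ) : ℝ)) ^ (d + 1) * (C * ((((bj ℓ j : ℕ) : ℝ) ^ (d + 1))⁻¹ * (sc ℓ k j ^ α * (sc ℓ k j)⁻¹))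
              * Real.exp (-(δ₁ * min (supNorm (x₁.1 - x.1)) (supNorm (x₂.1 - x.1)) / ((bj ℓ j : ℕ) : ℝ)))) :=
            mul_le_mul_of_nonneg_left hd (by positivity)
        _ = C * (((((ℓ + 1) ^ k : ℕ) : ℝ)) ^ (d + 1) * ((((bj ℓ j : ℕ) : ℝ) ^ (d + 1))⁻¹)
              * (sc ℓ k j ^ α * (sc ℓ k j)⁻¹))
              * Real.exp (-(δ₁ * min (supNorm (x₁.1 - x.1)) (supNorm (x₂.1 - x.1)) / ((bj ℓ j : ℕ) : ℝ))) := by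
            ring
        _ = _ := by rw [Lk_pow_mul_inv_bj_pow hj (d + 1)]
    · -- no pieces for `j ≥ k`
      have hj1 : 1 ≤ j := le_trans hk hkj
      have hp : piece ℓ k M j a m2 = 0 := piece_of_le hj1 hkj
      simp only [hp, Matrix.zero_apply, sub_self, abs_zero, mul_zero, zero_mul]
      exact hRHS
  · show (if h : x₁.1 + Pi.single μ 1 ∈ boxDom (Nf ℓ k M) ∧ x₂.1 + Pi.single μ 1 ∈ boxDom (Nf ℓ k M) then
        ((((ℓ + 1) ^ k : ℕ) : ℝ)) ^ (d + 1)
          * (((((ℓ + 1) ^ k : ℕ) : ℝ))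
            * |(piece ℓ k M j a m2 ⟨x₂.1 + Pi.single μ 1, h.2⟩ x - piece ℓ k M j a m2 x₂ x)
                - (piece ℓ k M j a m2 ⟨x₁.1 + Pi.single μ 1, h.1⟩ x - piece ℓ k M j a m2 x₁ x)|)
        else 0) * ((((ℓ + 1) ^ k : ℕ) : ℝ) / supNorm (x₂.1 - x₁.1)) ^ α ≤ _
    rw [dif_neg hmem, zero_mul]
    exact hRHS

/-- **Corollary (the typed shape, for a fixed exponent)**: if the constants of `Ineq211` are allowed to depend on `α`, the typed
predicate holds in the following sense — for every `0 ≤ α < 1` there are `δ₁, C > 0` such that every clause of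
`(zeroBoxKernelsH …).Ineq211 δ₁ C` whose exponent is this `α` holds. (Immediate from `ineq211At_zeroBoxH`; recorded to make the
quantifier relation to `ScaledKernels.Ineq211` explicit: `S.Ineq211 δ₁ C ↔ ∀ α, 0 ≤ α → α < 1 → [clause at α]` by `Iff.rfl`.)
[cite: Balaban1983Higgs3, (2.11) p.426] -/
theorem ineq211_iff_forall_clause (S : ScaledKernels) (δ₁ C : ℝ) :
    S.Ineq211 δ₁ C ↔ ∀ (α : ℝ), 0 ≤ α → α < 1 → ∀ (j : ℕ) (μ : S.Dir) (x₁ x₂ x : S.Site), x₁ ≠ x₂ →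
      S.holderDiff j μ x₁ x₂ x / S.dist x₁ x₂ ^ α ≤
        C * S.scale j ^ (1 - (S.d : ℝ) - α) * Real.exp (-(δ₁ * (S.scale j)⁻¹ * S.dist2 x₁ x₂ x)) :=
  Iff.rfl

/-! ## §5 Non-vacuity: the binders are inhabited (`d + 1 = 3`, `L = 2`, window `[1/2, 2] × [0, 1]`, `α = 1/2`, `k = 1`, unit cube) -/

/-- **Non-vacuity witness**: the (2.11) clause at `α = 1/2` holds, with the constants of `ineq211At_zeroBoxH` for `d + 1 = 3`, `L = 2`,
the window `[1/2, 2] × [0, 1]`, for the instance `k = 1`, `□ = [0,1)³`, `a = 1`, `m² = 0`. [cite: Balaban1983Higgs3, (2.11) p.426] -/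
theorem ineq211At_zeroBoxH_witness :
    ∃ δ₁ C : ℝ, 0 < δ₁ ∧ 0 < C ∧
      ∀ (j : ℕ) (μ : (zeroBoxKernelsH (d := 2) 1 1 le_rfl (fun _ => 1) 1 0).Dir)
        (x₁ x₂ x : (zeroBoxKernelsH (d := 2) 1 1 le_rfl (fun _ => 1) 1 0).Site), x₁ ≠ x₂ →
        (zeroBoxKernelsH (d := 2) 1 1 le_rfl (fun _ => 1) 1 0).holderDiff j μ x₁ x₂ x
            / (zeroBoxKernelsH (d := 2) 1 1 le_rfl (fun _ => 1) 1 0).dist x₁ x₂ ^ ((1 : ℝ) / 2) ≤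
          C * (zeroBoxKernelsH (d := 2) 1 1 le_rfl (fun _ => 1) 1 0).scale j
              ^ (1 - ((zeroBoxKernelsH (d := 2) 1 1 le_rfl (fun _ => 1) 1 0).d : ℝ) - (1 : ℝ) / 2)
            * Real.exp (-(δ₁ * ((zeroBoxKernelsH (d := 2) 1 1 le_rfl (fun _ => 1) 1 0).scale j)⁻¹
                * (zeroBoxKernelsH (d := 2) 1 1 le_rfl (fun _ => 1) 1 0).dist2 x₁ x₂ x)) := by
  obtain ⟨δ₁, C, hδ, hC, h⟩ := ineq211At_zeroBoxH 2 1 le_rfl (1 / 2) 2 1 (by norm_num) (α := (1 : ℝ) / 2)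
    (by norm_num) (by norm_num)
  exact ⟨δ₁, C, hδ, hC, h 1 le_rfl 1 0 (by norm_num) (by norm_num) le_rfl (by norm_num) _ fun _ => le_rfl⟩


/-! ## §6 (v1.1) Interpolation in the exponent: ONE pair of constants for all `α ∈ [0, α⋆]`, any `α⋆ < 1`

The print uses (2.11) at a FIXED exponent `α₀ < 1` ((3.3) p. 433: norms `‖·‖_{1,α₀}`).  The clauses at `α = 0` and at
`α = α⋆` imply the clause at every `α ∈ [0, α⋆]` with the constants `(min δ, max C)`: when `dist(x₁,x₂) ≥ L^jη` use `α = 0` and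
`dist^{−α} ≤ (L^jη)^{−α}`; when `dist(x₁,x₂) < L^jη` use `α⋆` and `dist^{α⋆−α} ≤ (L^jη)^{α⋆−α}`.  This holds on ANY carrier with
`dist ≥ 0`, `dist2 ≥ 0` (`ScaledKernels.ineq211_clause_interpolate`); for the instance it gives `ineq211Upto_zeroBoxH`. -/

/-- **Interpolation of the (2.11) clause in the Hölder exponent (abstract carrier)**: on a carrier with `dist ≥ 0` and
`dist2 ≥ 0`, the (2.11) clauses at `α = 0` (constants `δa, Ca`) and at `α = α⋆` (constants `δb, Cb`) imply the clause at
every `α ∈ [0, α⋆]` with the constants `(min δa δb, max Ca Cb)` (case `dist(x₁,x₂) ≥ L^jη`: from `α = 0`; case `< L^jη`: from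
`α⋆`). [cite: Balaban1983Higgs3, (2.11) p.426] -/
theorem _root_.Literature.MathematicalPhysics.QuantumFieldTheory.Balaban1983to89.B3Sect2StatementsPart2.ScaledKernels.ineq211_clause_interpolate
    (S : ScaledKernels) (hdist : ∀ x₁ x₂ : S.Site, 0 ≤ S.dist x₁ x₂) (hdist2 : ∀ x₁ x₂ x : S.Site, 0 ≤ S.dist2 x₁ x₂ x)
    {αs δa Ca δb Cb : ℝ} (hCa : 0 ≤ Ca) (hCb : 0 ≤ Cb)
    (h0 : ∀ (j : ℕ) (μ : S.Dir) (x₁ x₂ x : S.Site), x₁ ≠ x₂ →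
      S.holderDiff j μ x₁ x₂ x / S.dist x₁ x₂ ^ (0 : ℝ) ≤
        Ca * S.scale j ^ (1 - (S.d : ℝ) - 0) * Real.exp (-(δa * (S.scale j)⁻¹ * S.dist2 x₁ x₂ x)))
    (hs : ∀ (j : ℕ) (μ : S.Dir) (x₁ x₂ x : S.Site), x₁ ≠ x₂ →
      S.holderDiff j μ x₁ x₂ x / S.dist x₁ x₂ ^ αs ≤
        Cb * S.scale j ^ (1 - (S.d : ℝ) - αs) * Real.exp (-(δb * (S.scale j)⁻¹ * S.dist2 x₁ x₂ x))) :
    ∀ (α : ℝ), 0 ≤ α → α ≤ αs → ∀ (j : ℕ) (μ : S.Dir) (x₁ x₂ x : S.Site), x₁ ≠ x₂ →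
      S.holderDiff j μ x₁ x₂ x / S.dist x₁ x₂ ^ α ≤
        max Ca Cb * S.scale j ^ (1 - (S.d : ℝ) - α)
          * Real.exp (-(min δa δb * (S.scale j)⁻¹ * S.dist2 x₁ x₂ x)) := by
  intro α hα0 hαle j μ x₁ x₂ x hne
  have hL0 : 0 < S.L := lt_trans one_pos S.one_lt_L
  have hsc : 0 < S.scale j := mul_pos (pow_pos hL0 j) S.η_pos
  set s := S.scale j with hsdef
  set D := S.dist x₁ x₂ with hDdef
  set t := S.dist2 x₁ x₂ x with htdef
  set H := S.holderDiff j μ x₁ x₂ x with hHdef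
  have hD0 : 0 ≤ D := hdist x₁ x₂
  have ht0 : 0 ≤ t := hdist2 x₁ x₂ x
  have hst : 0 ≤ s⁻¹ * t := mul_nonneg (inv_pos.2 hsc).le ht0
  -- the exponentials at the smaller rate dominate
  have hEa : Real.exp (-(δa * s⁻¹ * t)) ≤ Real.exp (-(min δa δb * s⁻¹ * t)) := by
    rw [mul_assoc, mul_assoc]; exact exp_rate_mono (min_le_left _ _) hst
  have hEb : Real.exp (-(δb * s⁻¹ * t)) ≤ Real.exp (-(min δa δb * s⁻¹ * t)) := by
    rw [mul_assoc, mul_assoc]; exact exp_rate_mono (min_le_right _ _) hst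
  have hRHS0 : 0 ≤ max Ca Cb * s ^ (1 - (S.d : ℝ) - α) * Real.exp (-(min δa δb * s⁻¹ * t)) :=
    mul_nonneg (mul_nonneg (le_max_of_le_left hCa) (Real.rpow_pos_of_pos hsc _).le) (Real.exp_pos _).le
  have hsα : 0 < s ^ α := Real.rpow_pos_of_pos hsc α
  rcases hD0.eq_or_lt with hDz | hDpos
  · -- degenerate distance `D = 0`
    rcases hα0.eq_or_lt with hαz | hαpos
    · -- `α = 0`: the clause at `0` itself
      rw [← hαz]
      have h := h0 j μ x₁ x₂ x hne
      refine h.trans ?_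
      exact mul_le_mul (mul_le_mul_of_nonneg_right (le_max_left _ _) (Real.rpow_pos_of_pos hsc _).le) hEa
        (Real.exp_pos _).le (mul_nonneg (le_max_of_le_left hCa) (Real.rpow_pos_of_pos hsc _).le)
    · rw [← hDz, Real.zero_rpow hαpos.ne', div_zero]
      exact hRHS0
  · rcases le_or_gt s D with hsD | hDs
    · -- `dist ≥ L^jη`: the clause at `α = 0` and `D^{−α} ≤ s^{−α}`
      have h := h0 j μ x₁ x₂ x hne
      rw [Real.rpow_zero, div_one] at h
      have hDα : s ^ α ≤ D ^ α := Real.rpow_le_rpow hsc.le hsD hα0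
      have hinv : (D ^ α)⁻¹ ≤ (s ^ α)⁻¹ := inv_anti₀ hsα hDα
      have hpow : s ^ (1 - (S.d : ℝ) - 0) * (s ^ α)⁻¹ = s ^ (1 - (S.d : ℝ) - α) := by
        rw [← Real.rpow_neg hsc.le, ← Real.rpow_add hsc]
        congr 1
        ring
      have hB0 : 0 ≤ Ca * s ^ (1 - (S.d : ℝ) - 0) * Real.exp (-(δa * s⁻¹ * t)) :=
        mul_nonneg (mul_nonneg hCa (Real.rpow_pos_of_pos hsc _).le) (Real.exp_pos _).le
      calc H / D ^ α = H * (D ^ α)⁻¹ := div_eq_mul_inv _ _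
        _ ≤ Ca * s ^ (1 - (S.d : ℝ) - 0) * Real.exp (-(δa * s⁻¹ * t)) * (D ^ α)⁻¹ :=
            mul_le_mul_of_nonneg_right h (inv_pos.2 (Real.rpow_pos_of_pos hDpos α)).le
        _ ≤ Ca * s ^ (1 - (S.d : ℝ) - 0) * Real.exp (-(δa * s⁻¹ * t)) * (s ^ α)⁻¹ :=
            mul_le_mul_of_nonneg_left hinv hB0
        _ = Ca * (s ^ (1 - (S.d : ℝ) - 0) * (s ^ α)⁻¹) * Real.exp (-(δa * s⁻¹ * t)) := by ring
        _ = Ca * s ^ (1 - (S.d : ℝ) - α) * Real.exp (-(δa * s⁻¹ * t)) := by rw [hpow]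
        _ ≤ max Ca Cb * s ^ (1 - (S.d : ℝ) - α) * Real.exp (-(min δa δb * s⁻¹ * t)) :=
            mul_le_mul (mul_le_mul_of_nonneg_right (le_max_left _ _) (Real.rpow_pos_of_pos hsc _).le) hEa
              (Real.exp_pos _).le (mul_nonneg (le_max_of_le_left hCa) (Real.rpow_pos_of_pos hsc _).le)
    · -- `dist < L^jη`: the clause at `α⋆` and `D^{α⋆−α} ≤ s^{α⋆−α}`
      have h := hs j μ x₁ x₂ x hne
      have hDαs : 0 < D ^ αs := Real.rpow_pos_of_pos hDpos αs
      rw [div_le_iff₀ hDαs] at h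
      have hq : D ^ αs * (D ^ α)⁻¹ = D ^ (αs - α) := by
        rw [Real.rpow_sub hDpos]; ring
      have hDle : D ^ (αs - α) ≤ s ^ (αs - α) := Real.rpow_le_rpow hD0 hDs.le (sub_nonneg.2 hαle)
      have hpow : s ^ (1 - (S.d : ℝ) - αs) * s ^ (αs - α) = s ^ (1 - (S.d : ℝ) - α) := by
        rw [← Real.rpow_add hsc]
        congr 1
        ring
      have hB0 : 0 ≤ Cb * s ^ (1 - (S.d : ℝ) - αs) * Real.exp (-(δb * s⁻¹ * t)) :=
        mul_nonneg (mul_nonneg hCb (Real.rpow_pos_of_pos hsc _).le) (Real.exp_pos _).le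
      calc H / D ^ α = H * (D ^ α)⁻¹ := div_eq_mul_inv _ _
        _ ≤ Cb * s ^ (1 - (S.d : ℝ) - αs) * Real.exp (-(δb * s⁻¹ * t)) * D ^ αs * (D ^ α)⁻¹ :=
            mul_le_mul_of_nonneg_right h (inv_pos.2 (Real.rpow_pos_of_pos hDpos α)).le
        _ = Cb * s ^ (1 - (S.d : ℝ) - αs) * Real.exp (-(δb * s⁻¹ * t)) * (D ^ αs * (D ^ α)⁻¹) := by ring
        _ = Cb * s ^ (1 - (S.d : ℝ) - αs) * Real.exp (-(δb * s⁻¹ * t)) * D ^ (αs - α) := by rw [hq]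
        _ ≤ Cb * s ^ (1 - (S.d : ℝ) - αs) * Real.exp (-(δb * s⁻¹ * t)) * s ^ (αs - α) :=
            mul_le_mul_of_nonneg_left hDle hB0
        _ = Cb * (s ^ (1 - (S.d : ℝ) - αs) * s ^ (αs - α)) * Real.exp (-(δb * s⁻¹ * t)) := by ring
        _ = Cb * s ^ (1 - (S.d : ℝ) - α) * Real.exp (-(δb * s⁻¹ * t)) := by rw [hpow]
        _ ≤ max Ca Cb * s ^ (1 - (S.d : ℝ) - α) * Real.exp (-(min δa δb * s⁻¹ * t)) :=
            mul_le_mul (mul_le_mul_of_nonneg_right (le_max_right _ _) (Real.rpow_pos_of_pos hsc _).le) hEb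
              (Real.exp_pos _).le (mul_nonneg (le_max_of_le_left hCa) (Real.rpow_pos_of_pos hsc _).le)

/-- **B3 (2.11) p. 426 for the model instance, UNIFORMLY IN THE EXPONENT ON `[0, α⋆]` for every `α⋆ < 1`** (the way the print uses
it: a fixed `α₀ < 1`, (3.3) p. 433): for every `0 ≤ α⋆ < 1` there are `δ₁ > 0`, `C > 0` (on `d`, `L`, the window, `α⋆`) such that for
every `k ≥ 1`, window point and box, the (2.11) clause of `zeroBoxKernelsH` holds for ALL `α ∈ [0, α⋆]` with these constants — from
`ineq211At_zeroBoxH` at `0` and at `α⋆` by `ScaledKernels.ineq211_clause_interpolate`.  (The typed `ScaledKernels.Ineq211 δ₁ C` = the case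
«`α⋆ = 1` excluded endpoint», i.e. `sup_{α<1} C(α) < ∞`, stays unclaimed: gap G-B3-11.) [cite: Balaban1983Higgs3, (2.11) p.426] -/
theorem ineq211Upto_zeroBoxH (d ℓ : ℕ) (hℓ : 1 ≤ ℓ) (amin aplus m2plus : ℝ) (ha : 0 < amin) {αs : ℝ} (hαs0 : 0 ≤ αs)
    (hαs1 : αs < 1) :
    ∃ δ₁ C : ℝ, 0 < δ₁ ∧ 0 < C ∧ ∀ (k : ℕ), 1 ≤ k → ∀ (a m2 : ℝ), amin ≤ a → a ≤ aplus → 0 ≤ m2 →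
      m2 ≤ m2plus → ∀ (M : Fin (d + 1) → ℕ), (∀ i, 1 ≤ M i) →
        ∀ (α : ℝ), 0 ≤ α → α ≤ αs →
        ∀ (j : ℕ) (μ : (zeroBoxKernelsH ℓ k hℓ M a m2).Dir) (x₁ x₂ x : (zeroBoxKernelsH ℓ k hℓ M a m2).Site), x₁ ≠ x₂ →
          (zeroBoxKernelsH ℓ k hℓ M a m2).holderDiff j μ x₁ x₂ x / (zeroBoxKernelsH ℓ k hℓ M a m2).dist x₁ x₂ ^ α ≤
            C * (zeroBoxKernelsH ℓ k hℓ M a m2).scale j ^ (1 - ((zeroBoxKernelsH ℓ k hℓ M a m2).d : ℝ) - α)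
              * Real.exp (-(δ₁ * ((zeroBoxKernelsH ℓ k hℓ M a m2).scale j)⁻¹
                  * (zeroBoxKernelsH ℓ k hℓ M a m2).dist2 x₁ x₂ x)) := by
  obtain ⟨δa, Ca, hδa, hCa, hA⟩ := ineq211At_zeroBoxH d ℓ hℓ amin aplus m2plus ha (α := 0) le_rfl one_pos
  obtain ⟨δb, Cb, hδb, hCb, hB⟩ := ineq211At_zeroBoxH d ℓ hℓ amin aplus m2plus ha hαs0 hαs1
  refine ⟨min δa δb, max Ca Cb, lt_min hδa hδb, lt_max_of_lt_left hCa, ?_⟩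
  intro k hk a m2 h1 h2 h3 h4 M hM
  have hLk : (0 : ℝ) < (((ℓ + 1) ^ k : ℕ) : ℝ) := by positivity
  refine (zeroBoxKernelsH ℓ k hℓ M a m2).ineq211_clause_interpolate ?_ ?_ hCa.le hCb.le
    (hA k hk a m2 h1 h2 h3 h4 M hM) (hB k hk a m2 h1 h2 h3 h4 M hM)
  · intro x₁ x₂
    exact div_nonneg (supNorm_nonneg _) hLk.le
  · intro x₁ x₂ x
    exact div_nonneg (le_min (supNorm_nonneg _) (supNorm_nonneg _)) hLk.le


/-! ## §7 (v1.1) The owner's DECL OF RECORD `ScaledKernels.Ineq211At` (B3Sect2StatementsPart2 gen-5 append, G-B3-11 ruling) DISCHARGED -/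

/-- **Row B3.Eq2.11 — the decl of record `ScaledKernels.Ineq211At α δ₁ C` (the display (2.11) at ONE Hölder exponent, r15 gen 5 after
G-B3-11) DISCHARGED for the model instance `A = B̃ = 0`, `Ω = □`**: for every `0 ≤ α < 1` there are `δ₁ > 0`, `C > 0` (on `d`, `L`, the
window, `α`) with `(zeroBoxKernelsH ℓ k hℓ M a m2).Ineq211At α δ₁ C` for every `k ≥ 1`, window point and box — `ineq211At_zeroBoxH`
verbatim (`Ineq211At` unfolds to its clause). [cite: Balaban1983Higgs3, (2.11) p.426] -/
theorem ineq211At_zeroBoxH' (d ℓ : ℕ) (hℓ : 1 ≤ ℓ) (amin aplus m2plus : ℝ) (ha : 0 < amin) {α : ℝ} (hα0 : 0 ≤ α)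
    (hα1 : α < 1) :
    ∃ δ₁ C : ℝ, 0 < δ₁ ∧ 0 < C ∧ ∀ (k : ℕ), 1 ≤ k → ∀ (a m2 : ℝ), amin ≤ a → a ≤ aplus → 0 ≤ m2 →
      m2 ≤ m2plus → ∀ (M : Fin (d + 1) → ℕ), (∀ i, 1 ≤ M i) →
        (zeroBoxKernelsH ℓ k hℓ M a m2).Ineq211At α δ₁ C :=
  ineq211At_zeroBoxH d ℓ hℓ amin aplus m2plus ha hα0 hα1

/-- **Row B3.Eq2.11, decl of record, UNIFORMLY on `[0, α⋆]`**: for every `0 ≤ α⋆ < 1` one pair `(δ₁, C)` with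
`(zeroBoxKernelsH ℓ k hℓ M a m2).Ineq211At α δ₁ C` for ALL `α ∈ [0, α⋆]`, every `k ≥ 1`, window point and box (`ineq211Upto_zeroBoxH`).
[cite: Balaban1983Higgs3, (2.11) p.426] -/
theorem ineq211At_zeroBoxH_upto (d ℓ : ℕ) (hℓ : 1 ≤ ℓ) (amin aplus m2plus : ℝ) (ha : 0 < amin) {αs : ℝ} (hαs0 : 0 ≤ αs)
    (hαs1 : αs < 1) :
    ∃ δ₁ C : ℝ, 0 < δ₁ ∧ 0 < C ∧ ∀ (k : ℕ), 1 ≤ k → ∀ (a m2 : ℝ), amin ≤ a → a ≤ aplus → 0 ≤ m2 →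
      m2 ≤ m2plus → ∀ (M : Fin (d + 1) → ℕ), (∀ i, 1 ≤ M i) →
        ∀ (α : ℝ), 0 ≤ α → α ≤ αs → (zeroBoxKernelsH ℓ k hℓ M a m2).Ineq211At α δ₁ C :=
  ineq211Upto_zeroBoxH d ℓ hℓ amin aplus m2plus ha hαs0 hαs1

/-- **Abstract uniform ⇒ per-α, and per-α at two exponents ⇒ uniform in between** (for carriers with `dist, dist2 ≥ 0`): the relation
between the two typed forms, packaged on `Ineq211At`. [cite: Balaban1983Higgs3, (2.11) p.426] -/
theorem _root_.Literature.MathematicalPhysics.QuantumFieldTheory.Balaban1983to89.B3Sect2StatementsPart2.ScaledKernels.Ineq211At.interpolate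
    {S : ScaledKernels} (hdist : ∀ x₁ x₂ : S.Site, 0 ≤ S.dist x₁ x₂) (hdist2 : ∀ x₁ x₂ x : S.Site, 0 ≤ S.dist2 x₁ x₂ x)
    {αs δa Ca δb Cb : ℝ} (hCa : 0 ≤ Ca) (hCb : 0 ≤ Cb) (h0 : S.Ineq211At 0 δa Ca) (hs : S.Ineq211At αs δb Cb)
    {α : ℝ} (hα0 : 0 ≤ α) (hαle : α ≤ αs) : S.Ineq211At α (min δa δb) (max Ca Cb) :=
  S.ineq211_clause_interpolate hdist hdist2 hCa hCb h0 hs α hα0 hαle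

/-- **Non-vacuity witness for the decl of record**: `Ineq211At (1/2) δ₁ C` holds for the instance `d + 1 = 3`, `L = 2`, `k = 1`,
`□ = [0,1)³`, `a = 1`, `m² = 0` with the constants of `ineq211At_zeroBoxH'` (window `[1/2, 2] × [0, 1]`). [cite: Balaban1983Higgs3, (2.11) p.426] -/
theorem ineq211At_zeroBoxH'_witness :
    ∃ δ₁ C : ℝ, 0 < δ₁ ∧ 0 < C ∧ (zeroBoxKernelsH (d := 2) 1 1 le_rfl (fun _ => 1) 1 0).Ineq211At ((1 : ℝ) / 2) δ₁ C := by
  obtain ⟨δ₁, C, hδ, hC, h⟩ := ineq211At_zeroBoxH' 2 1 le_rfl (1 / 2) 2 1 (by norm_num) (α := (1 : ℝ) / 2)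
    (by norm_num) (by norm_num)
  exact ⟨δ₁, C, hδ, hC, h 1 le_rfl 1 0 (by norm_num) (by norm_num) le_rfl (by norm_num) _ fun _ => le_rfl⟩

end

end Literature.MathematicalPhysics.QuantumFieldTheory.Balaban1983to89.B3Ineq211ZeroBox
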